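import Literature.Barriers.CriticalPhenomena.LongRangeTrivialityOnZ3Newman
import Literature.Probability.LatticeModels.LeeYangProofs
import Literature.NumberTheory.Sieve.ChenSwitchingConstant
import Mathlib.FieldTheory.IsAlgClosed.Basic
import Mathlib.Analysis.Complex.Polynomial.Basic
import Mathlib.Analysis.SpecialFunctions.Complex.Log
import Mathlib.Analysis.SpecialFunctions.Log.Deriv
import Mathlib.Analysis.Convex.SpecificFunctions.Basic

/-!
# `panis_mgfDeviation_le_ursellFourBoxSum` DISCHARGED through Lee–Yang: Newman's bounds on the moment
# generating function (Comm. Math. Phys. 41 (1975), Thm 4) proved for the finite-volume states, and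
# Panis's moment-generating-function display derived from them

Sibling of `Literature/Barriers/CriticalPhenomena/LongRangeTrivialityOnZ3.lean` (barrier catalogue
D-0021, sub-problem `Ising3DConformalLimit`). The named fact `panis_mgfDeviation_le_ursellFourBoxSum`
(`LongRangeTrivialityOnZ3Inputs.lean`) is the second display of the proof of Panis 2023, Theorem 5.5
(arXiv:2309.05797, p. 21): for the algebraically decaying couplings, `0 < β ≤ β_c`, `L, R ≥ 1`,
`f` continuous with `f = 0` off `[-R,R]^d` and real `z`,
`|⟨e^{zT_{f,L,β}}⟩_β - e^{(z²/2)⟨T_{f,L,β}²⟩_β}| ≤ C₁ z⁴ e^{(z²/2)⟨T_{|f|,L,β}²⟩_β} ‖f‖_∞⁴ S(β,L,R)`,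
`S = Σ_L(β)⁻² ∑_{Λ_{RL}⁴} |U₄^β|`. The printed derivation sums Aizenman's deviation-from-Wick bound
(Aizenman 1982, Prop. 12.1 = Panis Prop. 4.6, random currents; vendored as
`aizenman_pairInteraction_wickDeviation_le_finite` in `…Wick`, not proved in the tree). This file
proves the display UNCONDITIONALLY (`panis_mgfDeviation_le_ursellFourBoxSum_holds`, `C₁ = 1/24`)
by a different classical route — C. M. Newman's Lee–Yang method:

* the pointwise Gaussian (Wick) inequality `S^Λ_{2n}(x) ≤ 𝒢_n[S^Λ₂](x)` for every finite-volume
  state and all `x ∈ Λ^{2n}` (repetitions allowed) — the tree's `LongRangeIsing.corrIn_le_pairingSum`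
  (`…Newman`, from `PairIsing.avg_spinMonomial_le_pairingSum`; Newman, ZW 33 (1975), Thm 3);
* Newman, Comm. Math. Phys. 41 (1975) 1–9, Theorem 4, eq. (2.5), `k = 0, 1`: for `X` of type `𝓛`,
  `exp(∑_{n≤4} u_nrⁿ/n!) ≤ E(e^{rX}) ≤ exp(∑_{n≤2} u_nrⁿ/n!)`, and (Theorem 1 = Lee–Yang, §2)
  `X = ∑ λ_jσ_j` with `λ ≥ 0` is of type `𝓛`; at zero field `u₁ = u₃ = 0`, `u₂ = E X²`,
  `u₄ = E X⁴ - 3(EX²)²`, i.e. `exp(u₂r²/2 + u₄r⁴/24) ≤ E(e^{rX}) ≤ exp(u₂r²/2)`. PROVED here for the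
  finite-volume free-boundary zero-field states `⟨·⟩_{Λ,J,0,β}` of every ferromagnetic pair
  interaction (`LongRangeIsing.newman_mgf_bounds`) from the tree's Lee–Yang circle theorem
  `lee_yang_circle_theorem_finite_holds` (`LeeYangProofs`).

## 1. Newman's Theorem 4 from Lee–Yang (namespace `NewmanLeeYang`, then `LongRangeIsing`)

Newman derives (2.5) from the Hadamard factorisation `E(e^{zX}) = e^{bz²}∏(1 + z²/α_j²)` (his Prop. 2)
and `log(1+a) ≷` its truncated series. Mathlib has no Hadamard factorisation; it is replaced by the
FINITE factorisation of a polynomial: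
1. *Lattice reduction.* For `X = ∑ k_aσ_a` with `k_a ∈ ℕ_{≥1}`: `X = N = 2m - K`,
   `m = ∑_{σ_a=+1}k_a ∈ {0,…,K}`, and `∑_σ p_σe^{zN_σ} = e^{-zK}P(e^{2z})` for the polynomial
   `P(u) = ∑_σ p_σu^{m_σ}` (`genPoly`; `P(1) = 1`, `P(0) ≠ 0`, `deg P = K`).
2. *Lee–Yang.* The Gibbs sum `∑_σ w_c(σ)e^{∑ h_aσ_a}` does not vanish for `Re h_a > 0`
   (`sum_weight_mul_exp_ne_zero`, the tree's theorem transported from `Fin n → Bool`), and by the spin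
   flip neither for `Re h_a < 0`; hence every root of `P` lies on the unit circle
   (`norm_eq_one_of_isRoot`).
3. *Product formula.* `P` splits over `ℂ`; for real `t`,
   `M(t)² = ∏_r (1 + b_r sinh² t)` over the roots, `b_r = 2/(1 - Re u_r) ≥ 1` (`mgfN_sq_eq_prod`;
   `|e^s - u|² = 2e^s(cosh s - Re u)` for `|u| = 1`).
4. *Elementary bounds.* `log(1 + by²) ≥ by² - b²y⁴/2` (global lower bound
   `2 log M ≥ S₁t² - (S₂/2)t⁴`, `S_i = ∑ b_rⁱ`); Bernoulli and `cosh y ≤ e^{y²/2}` give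
   `1 + b sinh² y ≤ e^{by²}` for `b ≥ 1` (upper bound `2 log M ≤ S₁t²`); and the two fourth-order
   expansions of `2 log M` at `0` — from the product, `S₁t² + (S₁/3 - S₂/2)t⁴ + O(t⁶)`, and from the
   moments, `u₂t² + (u₄/12)t⁴ + O(t⁶)` (`cosh`-Taylor with remainder, `log(1+w) ≷` cubic Taylor) —
   give `S₁ = u₂` and `S₂/2 ≤ u₂/3 - u₄/12` (`coeff_nonpos_of_expansion_le`). Hence
   `exp(u₂t²/2 + u₄t⁴/24 - u₂t⁴/6) ≤ M(t) ≤ exp(u₂t²/2)` (`newman_bounds_lattice`,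
   `avg_exp_bounds_nat`).
5. *Rescaling.* `λ ≥ 0` real: `λ^{(k)}_a = (⌊(k+1)λ_a⌋+1)/(k+1)`, the lattice bound at `t/(k+1)`,
   and `k → ∞` (finite sums, continuous in `λ`; the error term `u₂t⁴/(6(k+1)²)` vanishes):
   `avg_exp_bounds`; for `⟨·⟩_{Λ,J,0,β}` through `expectIn_zero_eq_avg`: `newman_mgf_bounds`.

## 2. Panis's display from the two inequalities (`panis_mgfDeviation_le_ursellFourBoxSum_holds`)

In a box `Λ = Λ_M ⊇ Λ_{RL}`, `T_{f,L,β} = ∑_{x∈Λ} λ_xσ_x`, `λ_x = f(x/L)/Σ_L(β)^{1/2}` (`Σ_L(β)` the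
infinite-volume block variance, a constant); `m_{2n}(f) = ⟨T_f^{2n}⟩_Λ`, `V_f = ⟨T_f²⟩_Λ`, `g = |f|`.
1. `m_{2n}(f) - (2n-1)!!V_fⁿ = ∑_{x∈Λ^{2n}} ∏λ_{xᵢ}(S^Λ_{2n} - 𝒢_n[S^Λ₂])(x)` (`sum_prod_mul_pairingSum`),
   so `|m_{2n}(f) - (2n-1)!!V_fⁿ| ≤ (2n-1)!!V_gⁿ - m_{2n}(g)` (absolute values inside).
2. Summing `z^{2n}/(2n)!` in finite volume (`⟨e^{zT}⟩_Λ = ⟨cosh zT⟩_Λ` by flip symmetry, a finite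
   combination of `cosh` series): `|⟨e^{zT_f}⟩_Λ - e^{z²V_f/2}| ≤ e^{z²V_g/2} - ⟨e^{zT_g}⟩_Λ`.
3. Newman's bounds for `T_g`: `u₄ ≤ 0` and `e^{z²V_g/2} - ⟨e^{zT_g}⟩_Λ ≤ e^{z²V_g/2}|u₄|z⁴/24`,
   `|u₄| = |⟨T_g⁴⟩ - 3V_g²| = |∑_{Λ⁴}∏λ_{|xᵢ|}U₄^Λ| ≤ ‖f‖_∞⁴Σ_L⁻²∑_{Λ_{RL}⁴}|U₄^Λ|` (the three pairings).
4. `M → ∞` by the window law (`tendsto_expectIn_box_fun_smeared`, `tendsto_ursellFourIn_box`).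

Consequences: `panis_thm12_of_ursellFourBoxSum_le : panis_ursellFourBoxSum_le → panis_thm12` and
`LongRangeTrivialityOnZ3.of_ursellFourBoxSum_le` — the barrier now rests on the p. 22 bound alone
(itself reduced to the tree diagram bound and the infrared bounds in the sibling files).

## References

* C. M. Newman, Comm. Math. Phys. 41 (1975) 1–9: (1.1), Thm 1, §2 ¶1 (type `𝓛`), Prop. 2, Thm 4
  eq. (2.5) [Newman1975] (held: `paper:doi-10-1007-bf01608542`, read pp. 1–3).
* C. M. Newman, Z. Wahrsch. verw. Gebiete 33 (1975) 75–93, Thm 3 [Newman1975Gaussian] — via the tree.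
* T. D. Lee, C. N. Yang, Phys. Rev. 87 (1952) 410, App. II [LeeYang1952] — via `LeeYangProofs`.
* R. Panis, arXiv:2309.05797, proof of Theorem 5.5, first two displays (p. 21) [Panis2023Triviality].
* M. Aizenman, CDM 2020 (arXiv:2112.04248), (7.6)–(7.9): the same summation — background only.

## Mathlib

`Polynomial.Splits.eval_eq_prod_roots` with `IsAlgClosed.splits`, `Polynomial.mem_roots`,
`Complex.exp_log`, `Complex.norm_exp`, `one_add_mul_self_le_rpow_one_add` (Bernoulli),
`Real.cosh_le_exp_half_sq`, `Real.hasSum_cosh`, `hasSum_nat_add_iff'`, `Real.le_log_one_add_of_nonneg`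
(and the tree's `Literature.NumberTheory.Sieve.Chen.log_one_add_le_cubic`), `Real.log_multiset_prod`, `Multiset.prod_map_le_prod_map₀`, `ge_of_tendsto` with `Ioo_mem_nhdsGT`,
`Nat.floor_le` / `Nat.lt_floor_add_one`, `tendsto_one_div_add_atTop_nhds_zero_nat`.
-/

noncomputable section

namespace Literature.Barriers.CriticalPhenomena

open Literature.Probability.LatticeModels Literature.Probability.Percolation Filter Finset Polynomial
open _root_.MeasureTheory _root_.Topology
open scoped Nat

namespace NewmanLeeYang

/-! ### Part C. A polynomial with all its roots on the unit circle: `|P(e^s)|²` as a product -/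

/-- For a real number `a` and a complex number `r` on the unit circle,
`|a - r|² = a² - 2a Re r + 1`. [folklore] -/
theorem norm_sub_sq_of_norm_eq_one (a : ℝ) {r : ℂ} (hr : ‖r‖ = 1) :
    ‖(a : ℂ) - r‖ ^ 2 = a ^ 2 - 2 * a * r.re + 1 := by
  have h1 : r.re ^ 2 + r.im ^ 2 = 1 := by
    have := Complex.sq_norm r
    rw [hr, Complex.normSq_apply] at this
    nlinarith [this]
  rw [Complex.sq_norm, Complex.normSq_apply]
  simp only [Complex.sub_re, Complex.ofReal_re, Complex.sub_im, Complex.ofReal_im, zero_sub]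
  nlinarith [h1]

/-- For real `s` and `r` on the unit circle, `|e^s - r|² = 2e^s (cosh s - Re r)`. [folklore] -/
theorem norm_exp_sub_sq_of_norm_eq_one (s : ℝ) {r : ℂ} (hr : ‖r‖ = 1) :
    ‖((Real.exp s : ℝ) : ℂ) - r‖ ^ 2 = 2 * Real.exp s * (Real.cosh s - r.re) := by
  rw [norm_sub_sq_of_norm_eq_one _ hr, Real.cosh_eq]
  have h2 : Real.exp s * Real.exp (-s) = 1 := by rw [← Real.exp_add, add_neg_cancel, Real.exp_zero]
  linear_combination -h2

/-- **`|P(e^s)|²` for a polynomial with all its roots on the unit circle**: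
`|P(e^s)|² = |c|² ∏_r 2e^s (cosh s - Re u_r)` over the roots `u_r` (with multiplicity), `c` the
leading coefficient (`P` splits over `ℂ`). [folklore] -/
theorem norm_eval_exp_sq (P : Polynomial ℂ) (hP : ∀ u : ℂ, P.IsRoot u → ‖u‖ = 1) (s : ℝ) :
    ‖P.eval ((Real.exp s : ℝ) : ℂ)‖ ^ 2 =
      ‖P.leadingCoeff‖ ^ 2 * (P.roots.map fun r => 2 * Real.exp s * (Real.cosh s - r.re)).prod := by
  by_cases hP0 : P = 0
  · simp [hP0]
  rw [(IsAlgClosed.splits P).eval_eq_prod_roots, norm_mul, mul_pow]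
  congr 1
  have hnorm : ‖(P.roots.map fun r => ((Real.exp s : ℝ) : ℂ) - r).prod‖ =
      (P.roots.map fun r => ‖((Real.exp s : ℝ) : ℂ) - r‖).prod := by
    have h := Multiset.prod_hom' P.roots (normHom : ℂ →*₀ ℝ) fun r => ((Real.exp s : ℝ) : ℂ) - r
    simp only [normHom_apply] at h
    exact h.symm
  rw [hnorm, ← Multiset.prod_map_pow]
  refine congrArg _ (Multiset.map_congr rfl fun r hr => ?_)
  exact norm_exp_sub_sq_of_norm_eq_one s (hP r ((mem_roots hP0).1 hr))

/-! ### Part A. Elementary real inequalities -/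

section Elementary

/-- `w - w²/2 ≤ log(1+w)` for `w ≥ 0`, from Mathlib's `2w/(w+2) ≤ log(1+w)` (the tree's
`Literature.NumberTheory.LFunctions.NicolasK.log_one_add_ge`, restated here to keep the imports light).
[folklore] -/
theorem sub_sq_div_two_le_log_one_add {w : ℝ} (hw : 0 ≤ w) : w - w ^ 2 / 2 ≤ Real.log (1 + w) := by
  refine le_trans ?_ (Real.le_log_one_add_of_nonneg hw)
  rw [le_div_iff₀ (by linarith)]
  nlinarith [sq_nonneg w, mul_nonneg hw (sq_nonneg w)]

/-- **`1 + b sinh² y ≤ e^{by²}` for `b ≥ 1`**: `1 + bs ≤ (1+s)^b` (Bernoulli) with `s = sinh² y`,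
`1 + s = cosh² y ≤ e^{y²}` (`cosh y ≤ e^{y²/2}`). This gives Gaussian domination. [folklore] -/
theorem one_add_mul_sinh_sq_le_exp {b : ℝ} (hb : 1 ≤ b) (y : ℝ) :
    1 + b * Real.sinh y ^ 2 ≤ Real.exp (b * y ^ 2) := by
  set s : ℝ := Real.sinh y ^ 2 with hs
  have hs0 : 0 ≤ s := sq_nonneg _
  have h1 : 1 + s = Real.cosh y ^ 2 := by rw [Real.cosh_sq', hs]
  have h2 : Real.cosh y ^ 2 ≤ Real.exp (y ^ 2) := by
    calc Real.cosh y ^ 2 ≤ Real.exp (y ^ 2 / 2) ^ 2 :=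
          pow_le_pow_left₀ (Real.cosh_pos y).le (Real.cosh_le_exp_half_sq y) 2
      _ = Real.exp (y ^ 2) := by rw [← Real.exp_nat_mul]; congr 1; ring
  calc 1 + b * s ≤ (1 + s) ^ b := one_add_mul_self_le_rpow_one_add (by linarith) hb
    _ ≤ Real.exp (y ^ 2) ^ b := Real.rpow_le_rpow (by linarith) (h1 ▸ h2) (by linarith)
    _ = Real.exp (b * y ^ 2) := by rw [← Real.exp_mul]; congr 1; ring

/-- `1 + y²/2 + y⁴/24 ≤ cosh y` (drop the remaining, non-negative terms of the series). [folklore] -/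
theorem cosh_taylor_four_le (y : ℝ) : 1 + y ^ 2 / 2 + y ^ 4 / 24 ≤ Real.cosh y := by
  have h := sum_le_hasSum (Finset.range 3) (fun n _ => div_nonneg (by rw [pow_mul]; positivity) (Nat.cast_nonneg _))
    (Real.hasSum_cosh y)
  have hsum : ∑ i ∈ Finset.range 3, y ^ (2 * i) / ((2 * i)! : ℝ) = 1 + y ^ 2 / 2 + y ^ 4 / 24 := by
    simp only [Finset.sum_range_succ, Finset.sum_range_zero, Nat.factorial]
    norm_num
  linarith

/-- `cosh y ≤ 1 + y²/2 + y⁴/24 + (y⁶/720) cosh y` (bound the tail term by term: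
`(2k+6)! ≥ (2k)! · 720`). [folklore] -/
theorem cosh_le_taylor_four_add (y : ℝ) :
    Real.cosh y ≤ 1 + y ^ 2 / 2 + y ^ 4 / 24 + y ^ 6 / 720 * Real.cosh y := by
  have h := Real.hasSum_cosh y
  have htail := (hasSum_nat_add_iff' 3).mpr h
  have hsum : ∑ i ∈ Finset.range 3, y ^ (2 * i) / ((2 * i)! : ℝ) = 1 + y ^ 2 / 2 + y ^ 4 / 24 := by
    simp only [Finset.sum_range_succ, Finset.sum_range_zero, Nat.factorial]
    norm_num
  rw [hsum] at htail
  have hmaj : HasSum (fun k : ℕ => y ^ 6 / 720 * (y ^ (2 * k) / ((2 * k)! : ℝ))) (y ^ 6 / 720 * Real.cosh y) :=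
    h.mul_left _
  have hle : ∀ k : ℕ, y ^ (2 * (k + 3)) / ((2 * (k + 3))! : ℝ) ≤ y ^ 6 / 720 * (y ^ (2 * k) / ((2 * k)! : ℝ)) := by
    intro k
    have hfac : ((2 * k)! : ℝ) * 720 ≤ ((2 * (k + 3))! : ℝ) := by
      have hdvd := Nat.factorial_mul_factorial_dvd_factorial_add (2 * k) 6
      have h6 : (6 : ℕ)! = 720 := by decide
      rw [h6, show 2 * k + 6 = 2 * (k + 3) by ring] at hdvd
      exact_mod_cast Nat.le_of_dvd (Nat.factorial_pos _) hdvd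
    have hpow : y ^ (2 * (k + 3)) = y ^ 6 * y ^ (2 * k) := by rw [← pow_add]; congr 1; ring
    have hy0 : 0 ≤ y ^ 6 * y ^ (2 * k) := by rw [← hpow, pow_mul]; positivity
    rw [hpow, div_mul_div_comm]
    exact div_le_div_of_nonneg_left hy0 (by positivity) (by linarith)
  have := hasSum_le hle htail hmaj
  linarith

/-- `sinh² y = (cosh 2y - 1)/2`. [folklore] -/
theorem sinh_sq_eq_cosh_two_mul (y : ℝ) : Real.sinh y ^ 2 = (Real.cosh (2 * y) - 1) / 2 := by
  rw [Real.cosh_two_mul, Real.cosh_sq']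
  ring

/-- `y² ≤ sinh² y`. [folklore] -/
theorem sq_le_sinh_sq (y : ℝ) : y ^ 2 ≤ Real.sinh y ^ 2 := by
  have h : |y| ≤ |Real.sinh y| := by
    rw [Real.abs_sinh]
    exact Real.self_le_sinh_iff.2 (abs_nonneg y)
  calc y ^ 2 = |y| ^ 2 := (sq_abs y).symm
    _ ≤ |Real.sinh y| ^ 2 := pow_le_pow_left₀ (abs_nonneg _) h 2
    _ = Real.sinh y ^ 2 := sq_abs _

/-- `sinh² y ≤ y² + y⁴/3 + (2/45) cosh(2) y⁶` for `|y| ≤ 1`. [folklore] -/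
theorem sinh_sq_le (y : ℝ) (hy : |y| ≤ 1) :
    Real.sinh y ^ 2 ≤ y ^ 2 + y ^ 4 / 3 + 2 / 45 * Real.cosh 2 * y ^ 6 := by
  rw [sinh_sq_eq_cosh_two_mul]
  have h := cosh_le_taylor_four_add (2 * y)
  have hc : Real.cosh (2 * y) ≤ Real.cosh 2 := by
    rw [Real.cosh_le_cosh, abs_mul, abs_two]
    have h2 : |(2 : ℝ)| = 2 := abs_two
    linarith [h2.le, h2.ge]
  have hy6 : 0 ≤ y ^ 6 := by positivity
  nlinarith [mul_le_mul_of_nonneg_left hc hy6]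

/-- **Global lower bound for one factor**: `by² - b²y⁴/2 ≤ log(1 + b sinh² y)` (`b ≥ 0`). [folklore] -/
theorem log_one_add_mul_sinh_sq_ge {b : ℝ} (hb : 0 ≤ b) (y : ℝ) :
    b * y ^ 2 - b ^ 2 * y ^ 4 / 2 ≤ Real.log (1 + b * Real.sinh y ^ 2) := by
  have h1 : b * y ^ 2 - (b * y ^ 2) ^ 2 / 2 ≤ Real.log (1 + b * y ^ 2) :=
    sub_sq_div_two_le_log_one_add (by positivity)
  have h2 : Real.log (1 + b * y ^ 2) ≤ Real.log (1 + b * Real.sinh y ^ 2) :=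
    Real.log_le_log (by positivity) (by nlinarith [sq_le_sinh_sq y, mul_le_mul_of_nonneg_left (sq_le_sinh_sq y) hb])
  calc b * y ^ 2 - b ^ 2 * y ^ 4 / 2 = b * y ^ 2 - (b * y ^ 2) ^ 2 / 2 := by ring
    _ ≤ _ := h1.trans h2

/-- The constant `C₀ = (2/45) cosh 2` of `sinh_sq_le`. [folklore] -/
def sinhSqRem : ℝ := 2 / 45 * Real.cosh 2

/-- `0 ≤ C₀`. [folklore] -/
theorem sinhSqRem_nonneg : 0 ≤ sinhSqRem := by unfold sinhSqRem; positivity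

/-- **Local upper bound for one factor** (`|y| ≤ 1`, `b ≥ 0`):
`log(1 + b sinh² y) ≤ by² + (b/3 - b²/2)y⁴ + (bC₀ + b³(4/3+C₀)³/3) y⁶` — from
`log(1+s) ≤ s - s²/2 + s³/3`, `by² ≤ s ≤ b(y² + y⁴/3 + C₀y⁶) ≤ b(4/3+C₀)y²`; the coefficient of
`y⁴` is exact. [folklore] -/
theorem log_one_add_mul_sinh_sq_le {b : ℝ} (hb : 0 ≤ b) {y : ℝ} (hy : |y| ≤ 1) :
    Real.log (1 + b * Real.sinh y ^ 2) ≤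
      b * y ^ 2 + (b / 3 - b ^ 2 / 2) * y ^ 4 + (b * sinhSqRem + b ^ 3 * (4 / 3 + sinhSqRem) ^ 3 / 3) * y ^ 6 := by
  set s : ℝ := b * Real.sinh y ^ 2 with hs
  set q : ℝ := y ^ 2 + y ^ 4 / 3 + sinhSqRem * y ^ 6 with hq
  have hs0 : 0 ≤ s := by positivity
  have hy2 : y ^ 2 ≤ 1 := by
    have := (sq_abs y).symm
    nlinarith [abs_nonneg y]
  have hy20 : 0 ≤ y ^ 2 := sq_nonneg y
  have hlog := Literature.NumberTheory.Sieve.Chen.log_one_add_le_cubic hs0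
  -- `s ≤ b q`
  have hsq : s ≤ b * q := by
    have h := sinh_sq_le y hy
    have : Real.sinh y ^ 2 ≤ q := by rw [hq]; unfold sinhSqRem; linarith
    exact mul_le_mul_of_nonneg_left this hb
  -- `s² ≥ b² y⁴`
  have hs2 : b ^ 2 * y ^ 4 ≤ s ^ 2 := by
    have h1 : b * y ^ 2 ≤ s := mul_le_mul_of_nonneg_left (sq_le_sinh_sq y) hb
    have h0 : 0 ≤ b * y ^ 2 := by positivity
    calc b ^ 2 * y ^ 4 = (b * y ^ 2) ^ 2 := by ring
      _ ≤ s ^ 2 := pow_le_pow_left₀ h0 h1 2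
  -- `q ≤ (4/3 + C₀) y²`
  have hq2 : q ≤ (4 / 3 + sinhSqRem) * y ^ 2 := by
    have h4 : y ^ 4 ≤ y ^ 2 := by nlinarith
    have h6 : y ^ 6 ≤ y ^ 2 := by nlinarith
    rw [hq]
    nlinarith [sinhSqRem_nonneg, mul_le_mul_of_nonneg_left h6 sinhSqRem_nonneg]
  have hq0 : 0 ≤ q := by rw [hq]; have := sinhSqRem_nonneg; positivity
  -- `s³ ≤ b³ (4/3+C₀)³ y⁶`
  have hs3 : s ^ 3 ≤ b ^ 3 * (4 / 3 + sinhSqRem) ^ 3 * y ^ 6 := by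
    have h1 : s ≤ b * ((4 / 3 + sinhSqRem) * y ^ 2) := hsq.trans (mul_le_mul_of_nonneg_left hq2 hb)
    calc s ^ 3 ≤ (b * ((4 / 3 + sinhSqRem) * y ^ 2)) ^ 3 := pow_le_pow_left₀ hs0 h1 3
      _ = b ^ 3 * (4 / 3 + sinhSqRem) ^ 3 * y ^ 6 := by ring
  calc Real.log (1 + s) ≤ s - s ^ 2 / 2 + s ^ 3 / 3 := hlog
    _ ≤ b * q - b ^ 2 * y ^ 4 / 2 + b ^ 3 * (4 / 3 + sinhSqRem) ^ 3 * y ^ 6 / 3 := by linarith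
    _ = b * y ^ 2 + (b / 3 - b ^ 2 / 2) * y ^ 4 + (b * sinhSqRem + b ^ 3 * (4 / 3 + sinhSqRem) ^ 3 / 3) * y ^ 6 := by
        rw [hq]; ring

end Elementary

/-! ### Part B. Comparing fourth-order expansions at `t = 0` -/

section Squeeze

/-- If `a ≤ c t²` for all small `t > 0`, then `a ≤ 0`. [folklore] -/
theorem nonpos_of_le_mul_sq {a c ε : ℝ} (hε : 0 < ε) (h : ∀ t : ℝ, 0 < t → t < ε → a ≤ c * t ^ 2) : a ≤ 0 := by
  have ht : Tendsto (fun t : ℝ => c * t ^ 2) (𝓝[>] 0) (𝓝 0) := by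
    have hc : Continuous fun t : ℝ => c * t ^ 2 := by fun_prop
    have := hc.tendsto 0
    simp only [ne_eq, OfNat.ofNat_ne_zero, not_false_eq_true, zero_pow, mul_zero] at this
    exact this.mono_left nhdsWithin_le_nhds
  refine ge_of_tendsto ht ?_
  filter_upwards [Ioo_mem_nhdsGT hε] with t ht
  exact h t ht.1 ht.2

/-- **Comparison of expansions.** If `αt² + βt⁴ ≤ γt⁶` for all small `t > 0`, then `α ≤ 0`, and
if moreover `α ≥ 0` then `β ≤ 0`. [folklore] -/
theorem coeff_nonpos_of_expansion_le {α β γ ε : ℝ} (hε : 0 < ε)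
    (h : ∀ t : ℝ, 0 < t → t < ε → α * t ^ 2 + β * t ^ 4 ≤ γ * t ^ 6) :
    α ≤ 0 ∧ (0 ≤ α → β ≤ 0) := by
  have hε1 : 0 < min ε 1 := lt_min hε one_pos
  constructor
  · refine nonpos_of_le_mul_sq (c := |β| + |γ|) hε1 fun t ht0 htε => ?_
    have ht1 : t < 1 := htε.trans_le (min_le_right _ _)
    have h1 := h t ht0 (htε.trans_le (min_le_left _ _))
    have ht2 : 0 < t ^ 2 := pow_pos ht0 2
    have ht4 : t ^ 4 ≤ t ^ 2 := by
      have h' : t ^ 2 ≤ 1 := by nlinarith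
      calc t ^ 4 = t ^ 2 * t ^ 2 := by ring
        _ ≤ t ^ 2 * 1 := mul_le_mul_of_nonneg_left h' ht2.le
        _ = t ^ 2 := mul_one _
    -- divide by `t²`
    have h2 : α ≤ -β * t ^ 2 + γ * t ^ 4 := by
      have : α * t ^ 2 ≤ (-β * t ^ 2 + γ * t ^ 4) * t ^ 2 := by nlinarith
      exact le_of_mul_le_mul_right this ht2
    have e1 : -β * t ^ 2 ≤ |β| * t ^ 2 := mul_le_mul_of_nonneg_right (neg_le_abs β) ht2.le
    have e2 : γ * t ^ 4 ≤ |γ| * t ^ 4 := mul_le_mul_of_nonneg_right (le_abs_self γ) (by positivity)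
    have e3 : |γ| * t ^ 4 ≤ |γ| * t ^ 2 := mul_le_mul_of_nonneg_left ht4 (abs_nonneg γ)
    calc α ≤ -β * t ^ 2 + γ * t ^ 4 := h2
      _ ≤ |β| * t ^ 2 + |γ| * t ^ 2 := by linarith
      _ = (|β| + |γ|) * t ^ 2 := by ring
  · intro hα
    refine nonpos_of_le_mul_sq (c := |γ|) hε1 fun t ht0 htε => ?_
    have h1 := h t ht0 (htε.trans_le (min_le_left _ _))
    have ht4 : 0 < t ^ 4 := pow_pos ht0 4
    have h2 : β * t ^ 4 ≤ γ * t ^ 6 := by nlinarith [pow_pos ht0 2]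
    have h3 : β ≤ γ * t ^ 2 := by
      have : β * t ^ 4 ≤ (γ * t ^ 2) * t ^ 4 := by nlinarith
      exact le_of_mul_le_mul_right this ht4
    calc β ≤ γ * t ^ 2 := h3
      _ ≤ |γ| * t ^ 2 := by nlinarith [le_abs_self γ, pow_pos ht0 2]

end Squeeze

/-! ### Part B'. A product `∏_r (1 + b_r sinh² t)`, `b_r ≥ 1`: bounds and expansion of its logarithm -/

section ProdBounds

variable (bs : Multiset ℝ)

/-- `S₁ = ∑ b_r`. [folklore] -/
def bSum₁ : ℝ := bs.sum

/-- `S₂ = ∑ b_r²`. [folklore] -/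
def bSum₂ : ℝ := (bs.map fun b => b ^ 2).sum

/-- The sixth-order constant `C_P = ∑_r (b_rC₀ + b_r³(4/3+C₀)³/3)`. [folklore] -/
def bRem : ℝ := (bs.map fun b => b * sinhSqRem + b ^ 3 * (4 / 3 + sinhSqRem) ^ 3 / 3).sum

variable {bs}

/-- The factors `1 + b sinh² t` are positive (`b ≥ 0`). [folklore] -/
theorem one_add_mul_sinh_sq_pos {b : ℝ} (hb : 0 ≤ b) (t : ℝ) : 0 < 1 + b * Real.sinh t ^ 2 := by positivity

/-- `log ∏_r (1 + b_r sinh² t) = ∑_r log(1 + b_r sinh² t)`. [folklore] -/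
theorem log_prod_eq_sum (hb : ∀ b ∈ bs, 1 ≤ b) (t : ℝ) :
    Real.log (bs.map fun b => 1 + b * Real.sinh t ^ 2).prod =
      (bs.map fun b => Real.log (1 + b * Real.sinh t ^ 2)).sum := by
  rw [Real.log_multiset_prod, Multiset.map_map]
  · rfl
  · intro x hx
    rw [Multiset.mem_map] at hx
    obtain ⟨b, hb', rfl⟩ := hx
    exact (one_add_mul_sinh_sq_pos (by linarith [hb b hb']) t).ne'

/-- Sums of two-term combinations over a multiset. [folklore] -/
theorem sum_map_two (f g : ℝ → ℝ) (x y : ℝ) :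
    (bs.map fun b => f b * x + g b * y).sum = (bs.map f).sum * x + (bs.map g).sum * y := by
  rw [Multiset.sum_map_add, Multiset.sum_map_mul_right, Multiset.sum_map_mul_right]

/-- Sums of three-term combinations over a multiset. [folklore] -/
theorem sum_map_three (f g h : ℝ → ℝ) (x y z : ℝ) :
    (bs.map fun b => f b * x + g b * y + h b * z).sum =
      (bs.map f).sum * x + (bs.map g).sum * y + (bs.map h).sum * z := by
  rw [Multiset.sum_map_add, sum_map_two, Multiset.sum_map_mul_right]

/-- **Gaussian upper bound**: `log ∏(1 + b_r sinh² t) ≤ S₁ t²` (`b_r ≥ 1`). [folklore] -/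
theorem log_prod_le_bSum₁ (hb : ∀ b ∈ bs, 1 ≤ b) (t : ℝ) :
    Real.log (bs.map fun b => 1 + b * Real.sinh t ^ 2).prod ≤ bSum₁ bs * t ^ 2 := by
  have h1 : (bs.map fun b => 1 + b * Real.sinh t ^ 2).prod ≤ (bs.map fun b => Real.exp (b * t ^ 2)).prod :=
    Multiset.prod_map_le_prod_map₀ _ _ (fun b hb' => (one_add_mul_sinh_sq_pos (by linarith [hb b hb']) t).le)
      fun b hb' => one_add_mul_sinh_sq_le_exp (hb b hb') t
  have h2 : (bs.map fun b => Real.exp (b * t ^ 2)).prod = Real.exp (bSum₁ bs * t ^ 2) := by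
    have e : bSum₁ bs * t ^ 2 = (bs.map fun b => b * t ^ 2).sum := by
      rw [Multiset.sum_map_mul_right, Multiset.map_id', bSum₁]
    rw [e, Real.exp_multiset_sum, Multiset.map_map]
    rfl
  have h0 : 0 < (bs.map fun b => 1 + b * Real.sinh t ^ 2).prod :=
    Multiset.prod_pos fun x hx => by
      rw [Multiset.mem_map] at hx
      obtain ⟨b, hb', rfl⟩ := hx
      exact one_add_mul_sinh_sq_pos (by linarith [hb b hb']) t
  calc Real.log (bs.map fun b => 1 + b * Real.sinh t ^ 2).prod
      ≤ Real.log (Real.exp (bSum₁ bs * t ^ 2)) := Real.log_le_log h0 (h2 ▸ h1)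
    _ = bSum₁ bs * t ^ 2 := Real.log_exp _

/-- **Global lower bound**: `S₁t² - (S₂/2)t⁴ ≤ log ∏(1 + b_r sinh² t)`. [folklore] -/
theorem bSum_le_log_prod (hb : ∀ b ∈ bs, 1 ≤ b) (t : ℝ) :
    bSum₁ bs * t ^ 2 - bSum₂ bs / 2 * t ^ 4 ≤ Real.log (bs.map fun b => 1 + b * Real.sinh t ^ 2).prod := by
  rw [log_prod_eq_sum hb]
  have h : (bs.map fun b => b * t ^ 2 - b ^ 2 * t ^ 4 / 2).sum ≤
      (bs.map fun b => Real.log (1 + b * Real.sinh t ^ 2)).sum :=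
    Multiset.sum_map_le_sum_map _ _ fun b hb' => log_one_add_mul_sinh_sq_ge (by linarith [hb b hb']) t
  have heq : (bs.map fun b => b * t ^ 2 - b ^ 2 * t ^ 4 / 2).sum = bSum₁ bs * t ^ 2 - bSum₂ bs / 2 * t ^ 4 := by
    have e : (bs.map fun b => b * t ^ 2 - b ^ 2 * t ^ 4 / 2).sum =
        (bs.map fun b => (fun b : ℝ => b) b * t ^ 2 + (fun b : ℝ => b ^ 2) b * (-(t ^ 4) / 2)).sum :=
      congrArg _ (Multiset.map_congr rfl fun b _ => by ring)
    rw [e, sum_map_two, Multiset.map_id', bSum₁, bSum₂]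
    ring
  linarith

/-- **Local upper bound (`|t| ≤ 1`)**: `log ∏(1 + b_r sinh² t) ≤ S₁t² + (S₁/3 - S₂/2)t⁴ + C_P t⁶`
(exact fourth-order coefficient). [folklore] -/
theorem log_prod_le_expansion (hb : ∀ b ∈ bs, 1 ≤ b) {t : ℝ} (ht : |t| ≤ 1) :
    Real.log (bs.map fun b => 1 + b * Real.sinh t ^ 2).prod ≤
      bSum₁ bs * t ^ 2 + (bSum₁ bs / 3 - bSum₂ bs / 2) * t ^ 4 + bRem bs * t ^ 6 := by
  rw [log_prod_eq_sum hb]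
  have h : (bs.map fun b => Real.log (1 + b * Real.sinh t ^ 2)).sum ≤
      (bs.map fun b => b * t ^ 2 + (b / 3 - b ^ 2 / 2) * t ^ 4 + (b * sinhSqRem + b ^ 3 * (4 / 3 + sinhSqRem) ^ 3 / 3) * t ^ 6).sum :=
    Multiset.sum_map_le_sum_map _ _ fun b hb' => log_one_add_mul_sinh_sq_le (by linarith [hb b hb']) ht
  have heq : (bs.map fun b => b * t ^ 2 + (b / 3 - b ^ 2 / 2) * t ^ 4 + (b * sinhSqRem + b ^ 3 * (4 / 3 + sinhSqRem) ^ 3 / 3) * t ^ 6).sum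
      = bSum₁ bs * t ^ 2 + (bSum₁ bs / 3 - bSum₂ bs / 2) * t ^ 4 + bRem bs * t ^ 6 := by
    have e : (bs.map fun b => b * t ^ 2 + (b / 3 - b ^ 2 / 2) * t ^ 4 + (b * sinhSqRem + b ^ 3 * (4 / 3 + sinhSqRem) ^ 3 / 3) * t ^ 6).sum
        = (bs.map fun b => (fun b : ℝ => b) b * (t ^ 2 + t ^ 4 / 3) + (fun b : ℝ => b ^ 2) b * (-(t ^ 4) / 2) +
            (fun b : ℝ => b * sinhSqRem + b ^ 3 * (4 / 3 + sinhSqRem) ^ 3 / 3) b * t ^ 6).sum :=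
      congrArg _ (Multiset.map_congr rfl fun b _ => by ring)
    rw [e, sum_map_three, Multiset.map_id', bSum₁, bSum₂, bRem]
    ring
  linarith

end ProdBounds

/-! ### Part D. A lattice distribution with the Lee–Yang property -/

section Core

variable {Ω : Type*} [Fintype Ω] (p : Ω → ℝ) (m : Ω → ℕ) (K : ℕ)

/-- The integer-valued variable `N = 2m - K` (in `ℝ`). [folklore] -/
def spinSum (τ : Ω) : ℝ := 2 * (m τ : ℝ) - K

/-- The generating polynomial `P(u) = ∑_τ p_τ u^{m_τ}` of the law of `m`. [folklore] -/
def genPoly : Polynomial ℂ := ∑ τ, Polynomial.C (p τ : ℂ) * Polynomial.X ^ (m τ)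

/-- The moment generating function `M(t) = ∑_τ p_τ e^{tN_τ}` of `N` (real argument). [folklore] -/
def mgfN (t : ℝ) : ℝ := ∑ τ, p τ * Real.exp (t * spinSum m K τ)

/-- `P(u) = ∑ p_τ u^{m_τ}`. [folklore] -/
theorem genPoly_eval (u : ℂ) : (genPoly p m).eval u = ∑ τ, (p τ : ℂ) * u ^ (m τ) := by
  simp [genPoly, Polynomial.eval_finsetSum]

/-- **`∑ p_τ e^{zN_τ} = e^{-zK} P(e^{2z})`** for complex `z`. [folklore] -/
theorem sum_exp_eq_genPoly_eval (z : ℂ) :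
    ∑ τ, (p τ : ℂ) * Complex.exp (z * (spinSum m K τ : ℂ)) =
      Complex.exp (-(z * K)) * (genPoly p m).eval (Complex.exp (2 * z)) := by
  rw [genPoly_eval, Finset.mul_sum]
  refine Finset.sum_congr rfl fun τ _ => ?_
  have h : Complex.exp (z * (spinSum m K τ : ℂ)) = Complex.exp (-(z * K)) * Complex.exp (2 * z) ^ (m τ) := by
    rw [← Complex.exp_nat_mul, ← Complex.exp_add]
    congr 1
    simp only [spinSum]
    push_cast
    ring
  rw [h]
  ring

/-- `P(1) = 1` (`∑ p_τ = 1`). [folklore] -/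
theorem genPoly_eval_one (hp1 : ∑ τ, p τ = 1) : (genPoly p m).eval 1 = 1 := by
  rw [genPoly_eval]
  simp only [one_pow, mul_one]
  rw [← Complex.ofReal_sum, hp1, Complex.ofReal_one]

/-- `P(0) ≠ 0` if some `m_τ = 0` (`p > 0`). [folklore] -/
theorem genPoly_eval_zero_ne (hp : ∀ τ, 0 < p τ) {τ₀ : Ω} (h0 : m τ₀ = 0) : (genPoly p m).eval 0 ≠ 0 := by
  rw [genPoly_eval]
  have h : ∑ τ, (p τ : ℂ) * (0 : ℂ) ^ (m τ) = ((∑ τ, if m τ = 0 then p τ else 0 : ℝ) : ℂ) := by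
    rw [Complex.ofReal_sum]
    refine Finset.sum_congr rfl fun τ _ => ?_
    by_cases hm : m τ = 0
    · simp [hm]
    · simp [hm]
  rw [h, Complex.ofReal_ne_zero]
  refine ne_of_gt (lt_of_lt_of_le (hp τ₀) ?_)
  have hle := Finset.single_le_sum (f := fun τ => if m τ = 0 then p τ else 0)
    (fun τ _ => by by_cases hm : m τ = 0 <;> simp [hm, (hp τ).le]) (Finset.mem_univ τ₀)
  simpa [h0] using hle

/-- The degree of `P` is `K` if `m ≤ K` and some `m_τ = K`. [folklore] -/
theorem natDegree_genPoly (hp : ∀ τ, 0 < p τ) (hmK : ∀ τ, m τ ≤ K) {τ₁ : Ω} (h1 : m τ₁ = K) :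
    (genPoly p m).natDegree = K := by
  refine Polynomial.natDegree_eq_of_le_of_coeff_ne_zero ?_ ?_
  · rw [genPoly]
    refine Polynomial.natDegree_sum_le_of_forall_le _ _ fun τ _ => ?_
    exact (Polynomial.natDegree_C_mul_X_pow_le _ _).trans (hmK τ)
  · rw [genPoly, Polynomial.finsetSum_coeff]
    have h : ∑ τ, (Polynomial.C (p τ : ℂ) * Polynomial.X ^ (m τ)).coeff K =
        ((∑ τ, if m τ = K then p τ else 0 : ℝ) : ℂ) := by
      rw [Complex.ofReal_sum]
      refine Finset.sum_congr rfl fun τ _ => ?_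
      rw [Polynomial.coeff_C_mul_X_pow]
      by_cases hm : m τ = K
      · simp [hm]
      · simp [hm, Ne.symm hm]
    rw [h, Complex.ofReal_ne_zero]
    refine ne_of_gt (lt_of_lt_of_le (hp τ₁) ?_)
    have hle := Finset.single_le_sum (f := fun τ => if m τ = K then p τ else 0)
      (fun τ _ => by by_cases hm : m τ = K <;> simp [hm, (hp τ).le]) (Finset.mem_univ τ₁)
    simpa [h1] using hle

variable {p m K}

/-- **The flip symmetry**: `∑ p_τ e^{zN_τ} = ∑ p_τ e^{-zN_τ}` when a weight-preserving bijection
`ψ` reverses `m ↦ K - m`. [folklore] -/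
theorem sum_exp_neg (ψ : Ω ≃ Ω) (hψp : ∀ τ, p (ψ τ) = p τ) (hψm : ∀ τ, m (ψ τ) + m τ = K) (z : ℂ) :
    ∑ τ, (p τ : ℂ) * Complex.exp (z * (spinSum m K τ : ℂ)) =
      ∑ τ, (p τ : ℂ) * Complex.exp (-z * (spinSum m K τ : ℂ)) := by
  rw [← Equiv.sum_comp ψ]
  refine Finset.sum_congr rfl fun τ _ => ?_
  rw [hψp]
  congr 2
  have h : (spinSum m K (ψ τ) : ℝ) = -spinSum m K τ := by
    simp only [spinSum]
    have := hψm τ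
    have h' : (m (ψ τ) : ℝ) = K - m τ := by
      have h'' : ((m (ψ τ) + m τ : ℕ) : ℝ) = K := by exact_mod_cast this
      push_cast at h''
      linarith
    rw [h']
    ring
  rw [h]
  push_cast
  ring

/-- **All roots of `P` lie on the unit circle** (Lee–Yang for `Re z > 0`, the flip for `Re z < 0`).
[cite: Newman1975, Theorem 1 and §2 (type 𝓛: purely imaginary zeros)] -/
theorem norm_eq_one_of_isRoot (hp : ∀ τ, 0 < p τ) (ψ : Ω ≃ Ω) (hψp : ∀ τ, p (ψ τ) = p τ)
    (hψm : ∀ τ, m (ψ τ) + m τ = K) {τ₀ : Ω} (h0 : m τ₀ = 0)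
    (hLY : ∀ z : ℂ, 0 < z.re → ∑ τ, (p τ : ℂ) * Complex.exp (z * (spinSum m K τ : ℂ)) ≠ 0)
    {u : ℂ} (hu : (genPoly p m).IsRoot u) : ‖u‖ = 1 := by
  have hu0 : u ≠ 0 := by
    rintro rfl
    exact genPoly_eval_zero_ne p m hp h0 hu
  set z : ℂ := Complex.log u / 2 with hz
  have hexp : Complex.exp (2 * z) = u := by
    rw [hz, mul_div_cancel₀ _ (two_ne_zero' ℂ), Complex.exp_log hu0]
  have hS : ∑ τ, (p τ : ℂ) * Complex.exp (z * (spinSum m K τ : ℂ)) = 0 := by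
    rw [sum_exp_eq_genPoly_eval, hexp, hu.eq_zero, mul_zero]
  rcases lt_trichotomy z.re 0 with hneg | hzero | hpos
  · exfalso
    refine hLY (-z) (by simpa using hneg) ?_
    rw [sum_exp_neg ψ hψp hψm] at hS
    exact hS
  · rw [← hexp, Complex.norm_exp]
    simp [hzero]
  · exact absurd hS (hLY z hpos)

/-- `M(0) = 1`. [folklore] -/
theorem mgfN_zero (hp1 : ∑ τ, p τ = 1) : mgfN p m K 0 = 1 := by
  simp [mgfN, hp1]

/-- `M(t) > 0`. [folklore] -/
theorem mgfN_pos (hp : ∀ τ, 0 < p τ) (τ₀ : Ω) (t : ℝ) : 0 < mgfN p m K t := by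
  rw [mgfN]
  have hle := Finset.single_le_sum (f := fun τ => p τ * Real.exp (t * spinSum m K τ))
    (fun τ _ => (mul_pos (hp τ) (Real.exp_pos _)).le) (Finset.mem_univ τ₀)
  exact lt_of_lt_of_le (mul_pos (hp τ₀) (Real.exp_pos _)) hle

/-- **`P(e^{2t}) = e^{tK} M(t)`** for real `t`. [folklore] -/
theorem genPoly_eval_exp (t : ℝ) :
    (genPoly p m).eval ((Real.exp (2 * t) : ℝ) : ℂ) = ((Real.exp (t * K) * mgfN p m K t : ℝ) : ℂ) := by
  have h := sum_exp_eq_genPoly_eval p m K (t : ℂ)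
  have hL : ∑ τ, (p τ : ℂ) * Complex.exp ((t : ℂ) * (spinSum m K τ : ℂ)) = ((mgfN p m K t : ℝ) : ℂ) := by
    rw [mgfN, Complex.ofReal_sum]
    refine Finset.sum_congr rfl fun τ _ => ?_
    push_cast
    ring_nf
  have hexp2 : Complex.exp (2 * (t : ℂ)) = ((Real.exp (2 * t) : ℝ) : ℂ) := by
    rw [Complex.ofReal_exp]; push_cast; ring_nf
  have hexpK : Complex.exp (-((t : ℂ) * K)) = ((Real.exp (-(t * K)) : ℝ) : ℂ) := by
    rw [Complex.ofReal_exp]; push_cast; ring_nf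
  rw [hL, hexp2, hexpK] at h
  -- `M = e^{-tK} P(e^{2t})`, so `P(e^{2t}) = e^{tK} M`
  have hne : ((Real.exp (-(t * K)) : ℝ) : ℂ) ≠ 0 := Complex.ofReal_ne_zero.2 (Real.exp_pos _).ne'
  have h2 : (genPoly p m).eval ((Real.exp (2 * t) : ℝ) : ℂ) =
      ((Real.exp (-(t * K)) : ℝ) : ℂ)⁻¹ * ((mgfN p m K t : ℝ) : ℂ) := by
    rw [eq_inv_mul_iff_mul_eq₀ hne, ← h]
  rw [h2, ← Complex.ofReal_inv, ← Complex.ofReal_mul, Real.exp_neg, inv_inv]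

/-- A root of `P` has real part `< 1` and `≥ -1` (it lies on the unit circle and is not `1`,
because `P(1) = 1`). [folklore] -/
theorem re_lt_one_of_mem_roots (hp1 : ∑ τ, p τ = 1) (hroots : ∀ u : ℂ, (genPoly p m).IsRoot u → ‖u‖ = 1)
    {r : ℂ} (hr : r ∈ (genPoly p m).roots) : r.re < 1 ∧ -1 ≤ r.re := by
  have hP0 : genPoly p m ≠ 0 := fun h => by
    have := genPoly_eval_one p m hp1
    rw [h, Polynomial.eval_zero] at this
    exact zero_ne_one this
  have hroot := (Polynomial.mem_roots hP0).1 hr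
  have hn := hroots r hroot
  have hre : |r.re| ≤ 1 := hn ▸ Complex.abs_re_le_norm r
  have hre1 : r.re ≠ 1 := by
    intro h1
    have him : r.im = 0 := by
      have h2 := Complex.sq_norm r
      rw [hn, Complex.normSq_apply, h1] at h2
      nlinarith
    have hr1 : r = 1 := Complex.ext (by simp [h1]) (by simp [him])
    rw [hr1] at hroot
    have := genPoly_eval_one p m hp1
    rw [hroot.eq_zero] at this
    exact zero_ne_one this
  exact ⟨lt_of_le_of_ne (abs_le.1 hre).2 hre1, (abs_le.1 hre).1⟩

/-- **The product formula**: `M(t)² = ∏_r (1 + b_r sinh² t)` over the roots `u_r` of `P`, with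
`b_r = 2/(1 - Re u_r)` (roots on the unit circle, `P(1) = 1`, `deg P = K`). This is the finite
substitute for Newman's Hadamard product `E(e^{zX}) = ∏(1 + z²/α_j²)`.
[cite: Newman1975, Proposition 2 (product representation), finite form] -/
theorem mgfN_sq_eq_prod (hp : ∀ τ, 0 < p τ) (hp1 : ∑ τ, p τ = 1) (hmK : ∀ τ, m τ ≤ K)
    (τ₀ : Ω) {τ₁ : Ω} (h1 : m τ₁ = K)
    (hroots : ∀ u : ℂ, (genPoly p m).IsRoot u → ‖u‖ = 1) (t : ℝ) :
    mgfN p m K t ^ 2 =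
      ((genPoly p m).roots.map fun r => 1 + 2 / (1 - r.re) * Real.sinh t ^ 2).prod := by
  set P := genPoly p m with hP
  set R := P.roots with hR
  set Pr : ℝ → ℝ := fun s => (R.map fun r => 1 + 2 / (1 - r.re) * Real.sinh s ^ 2).prod with hPr
  set D : ℝ := (R.map fun r => 2 * (1 - r.re)).prod with hD
  have hcard : R.card = K := by
    rw [hR, ← (IsAlgClosed.splits P).natDegree_eq_card_roots, hP, natDegree_genPoly p m K hp hmK h1]
  -- `‖P(e^{2s})‖² = ‖c‖² D e^{2sK} Pr(s)` for every real `s`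
  have key : ∀ s : ℝ, (Real.exp (s * K) * mgfN p m K s) ^ 2 =
      ‖P.leadingCoeff‖ ^ 2 * (D * (Real.exp (2 * s) ^ K * Pr s)) := by
    intro s
    have h1 := norm_eval_exp_sq P hroots (2 * s)
    have h2 : ‖P.eval ((Real.exp (2 * s) : ℝ) : ℂ)‖ = Real.exp (s * K) * mgfN p m K s := by
      rw [hP, genPoly_eval_exp s, Complex.norm_real, Real.norm_eq_abs,
        abs_of_pos (mul_pos (Real.exp_pos _) (mgfN_pos hp τ₀ s))]
    rw [h2] at h1
    rw [h1]
    congr 1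
    have hfac : ∀ r ∈ R, 2 * Real.exp (2 * s) * (Real.cosh (2 * s) - r.re) =
        (2 * (1 - r.re)) * (Real.exp (2 * s) * (1 + 2 / (1 - r.re) * Real.sinh s ^ 2)) := by
      intro r hr
      have hne : 1 - r.re ≠ 0 := by
        have := (re_lt_one_of_mem_roots hp1 hroots hr).1
        linarith
      have hc : Real.cosh (2 * s) = 1 + 2 * Real.sinh s ^ 2 := by
        rw [sinh_sq_eq_cosh_two_mul]; ring
      rw [hc]
      field_simp
      ring
    have e1 : (R.map fun r => Real.exp (2 * s) * (1 + 2 / (1 - r.re) * Real.sinh s ^ 2)).prod =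
        Real.exp (2 * s) ^ K * Pr s := by
      rw [Multiset.prod_map_mul, Multiset.map_const', Multiset.prod_replicate, hcard]
    rw [Multiset.map_congr rfl hfac, Multiset.prod_map_mul, e1]
  -- at `s = 0`: `‖c‖² D = 1`
  have hPr0 : Pr 0 = 1 := by
    simp only [hPr, Real.sinh_zero]
    rw [Multiset.map_congr rfl (fun r _ => by ring : ∀ r ∈ R, 1 + 2 / (1 - r.re) * (0 : ℝ) ^ 2 = 1),
      Multiset.map_const', Multiset.prod_replicate, one_pow]
  have h0 := key 0
  simp only [zero_mul, mul_zero, Real.exp_zero, mul_one, one_pow, mgfN_zero hp1, hPr0] at h0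
  -- at `s = t`
  have ht := key t
  rw [← mul_assoc, ← h0, one_mul, mul_pow] at ht
  have hK : Real.exp (2 * t) ^ K = Real.exp (t * K) ^ 2 := by
    rw [← Real.exp_nat_mul, ← Real.exp_nat_mul]; congr 1; ring
  rw [hK] at ht
  have hpos : 0 < Real.exp (t * K) ^ 2 := by positivity
  exact mul_left_cancel₀ hpos.ne' ht

/-- The coefficients `b_r = 2/(1 - Re u_r)` are `≥ 1`. [folklore] -/
theorem one_le_coeff_of_mem_roots (hp1 : ∑ τ, p τ = 1) (hroots : ∀ u : ℂ, (genPoly p m).IsRoot u → ‖u‖ = 1)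
    {b : ℝ} (hb : b ∈ (genPoly p m).roots.map fun r => 2 / (1 - r.re)) : 1 ≤ b := by
  rw [Multiset.mem_map] at hb
  obtain ⟨r, hr, rfl⟩ := hb
  obtain ⟨h1, h2⟩ := re_lt_one_of_mem_roots hp1 hroots hr
  rw [le_div_iff₀ (by linarith)]
  linarith

/-! #### The moment side: `2 log M(t) = u₂t² + (u₄/12)t⁴ + O(t⁶)` -/

omit [Fintype Ω] in
/-- `|N_τ| ≤ K`. [folklore] -/
theorem abs_spinSum_le (hmK : ∀ τ, m τ ≤ K) (τ : Ω) : |spinSum m K τ| ≤ K := by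
  rw [spinSum, abs_le]
  have h1 : (m τ : ℝ) ≤ K := by exact_mod_cast hmK τ
  have h2 : (0 : ℝ) ≤ m τ := Nat.cast_nonneg _
  constructor <;> linarith

/-- The flip symmetry, real form: `M(t) = ∑ p_τ cosh(tN_τ)`. [folklore] -/
theorem mgfN_eq_sum_cosh (ψ : Ω ≃ Ω) (hψp : ∀ τ, p (ψ τ) = p τ) (hψm : ∀ τ, m (ψ τ) + m τ = K) (t : ℝ) :
    mgfN p m K t = ∑ τ, p τ * Real.cosh (t * spinSum m K τ) := by
  have hflip : mgfN p m K t = ∑ τ, p τ * Real.exp (-(t * spinSum m K τ)) := by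
    rw [mgfN, ← Equiv.sum_comp ψ]
    refine Finset.sum_congr rfl fun τ _ => ?_
    rw [hψp]
    congr 2
    have h' : (m (ψ τ) : ℝ) = K - m τ := by
      have h'' : ((m (ψ τ) + m τ : ℕ) : ℝ) = K := by exact_mod_cast hψm τ
      push_cast at h''
      linarith
    simp only [spinSum, h']
    ring
  have h2 : mgfN p m K t + mgfN p m K t = ∑ τ, 2 * (p τ * Real.cosh (t * spinSum m K τ)) := by
    conv_lhs => arg 2; rw [hflip]
    rw [mgfN, ← Finset.sum_add_distrib]
    refine Finset.sum_congr rfl fun τ _ => ?_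
    rw [Real.cosh_eq]
    ring
  rw [← Finset.mul_sum] at h2
  linarith

/-- **Fourth-order expansion of `M` from below**: `1 + u₂t²/2 + m₄t⁴/24 ≤ M(t)`. [folklore] -/
theorem taylor_le_mgfN (hp : ∀ τ, 0 < p τ) (hp1 : ∑ τ, p τ = 1) (ψ : Ω ≃ Ω) (hψp : ∀ τ, p (ψ τ) = p τ)
    (hψm : ∀ τ, m (ψ τ) + m τ = K) (t : ℝ) :
    1 + (∑ τ, p τ * spinSum m K τ ^ 2) * t ^ 2 / 2 + (∑ τ, p τ * spinSum m K τ ^ 4) * t ^ 4 / 24 ≤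
      mgfN p m K t := by
  rw [mgfN_eq_sum_cosh ψ hψp hψm]
  have h : ∀ τ, p τ * (1 + (t * spinSum m K τ) ^ 2 / 2 + (t * spinSum m K τ) ^ 4 / 24) ≤
      p τ * Real.cosh (t * spinSum m K τ) := fun τ =>
    mul_le_mul_of_nonneg_left (cosh_taylor_four_le _) (hp τ).le
  have hsum := Finset.sum_le_sum fun τ (_ : τ ∈ Finset.univ) => h τ
  have heq : ∑ τ, p τ * (1 + (t * spinSum m K τ) ^ 2 / 2 + (t * spinSum m K τ) ^ 4 / 24) =
      1 + (∑ τ, p τ * spinSum m K τ ^ 2) * t ^ 2 / 2 + (∑ τ, p τ * spinSum m K τ ^ 4) * t ^ 4 / 24 := by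
    have e : ∀ τ, p τ * (1 + (t * spinSum m K τ) ^ 2 / 2 + (t * spinSum m K τ) ^ 4 / 24) =
        p τ + p τ * spinSum m K τ ^ 2 * (t ^ 2 / 2) + p τ * spinSum m K τ ^ 4 * (t ^ 4 / 24) := fun τ => by ring
    simp_rw [e]
    rw [Finset.sum_add_distrib, Finset.sum_add_distrib, ← Finset.sum_mul, ← Finset.sum_mul, hp1]
    ring
  linarith

/-- **Fourth-order expansion of `M` from above** (`|t| ≤ 1/(K+1)`):
`M(t) ≤ 1 + u₂t²/2 + m₄t⁴/24 + (K⁶ cosh 1/720) t⁶`. [folklore] -/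
theorem mgfN_le_taylor (hp : ∀ τ, 0 < p τ) (hp1 : ∑ τ, p τ = 1) (hmK : ∀ τ, m τ ≤ K) (ψ : Ω ≃ Ω)
    (hψp : ∀ τ, p (ψ τ) = p τ) (hψm : ∀ τ, m (ψ τ) + m τ = K) {t : ℝ} (ht : |t| ≤ 1 / (K + 1)) :
    mgfN p m K t ≤ 1 + (∑ τ, p τ * spinSum m K τ ^ 2) * t ^ 2 / 2 + (∑ τ, p τ * spinSum m K τ ^ 4) * t ^ 4 / 24 +
      (K : ℝ) ^ 6 * Real.cosh 1 / 720 * t ^ 6 := by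
  rw [mgfN_eq_sum_cosh ψ hψp hψm]
  have hK0 : (0 : ℝ) < K + 1 := by positivity
  have htN : ∀ τ, |t * spinSum m K τ| ≤ 1 := by
    intro τ
    rw [abs_mul]
    calc |t| * |spinSum m K τ| ≤ 1 / (K + 1) * K :=
          mul_le_mul ht (abs_spinSum_le hmK τ) (abs_nonneg _) (by positivity)
      _ ≤ 1 := by rw [div_mul_eq_mul_div, one_mul, div_le_one hK0]; linarith
  have h : ∀ τ, p τ * Real.cosh (t * spinSum m K τ) ≤
      p τ * (1 + (t * spinSum m K τ) ^ 2 / 2 + (t * spinSum m K τ) ^ 4 / 24 + (K : ℝ) ^ 6 * Real.cosh 1 / 720 * t ^ 6) := by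
    intro τ
    refine mul_le_mul_of_nonneg_left ((cosh_le_taylor_four_add _).trans ?_) (hp τ).le
    have h6 : (t * spinSum m K τ) ^ 6 ≤ t ^ 6 * (K : ℝ) ^ 6 := by
      rw [mul_pow]
      refine mul_le_mul_of_nonneg_left ?_ (by positivity)
      calc spinSum m K τ ^ 6 = |spinSum m K τ| ^ 6 := by rw [pow_abs, abs_of_nonneg (by positivity)]
        _ ≤ (K : ℝ) ^ 6 := pow_le_pow_left₀ (abs_nonneg _) (abs_spinSum_le hmK τ) 6
    have hc : Real.cosh (t * spinSum m K τ) ≤ Real.cosh 1 := by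
      rw [Real.cosh_le_cosh, abs_one]; exact htN τ
    have hc0 : 0 ≤ Real.cosh (t * spinSum m K τ) := (Real.cosh_pos _).le
    nlinarith [mul_le_mul h6 hc hc0 (by positivity)]
  have hsum := Finset.sum_le_sum fun τ (_ : τ ∈ Finset.univ) => h τ
  have heq : ∑ τ, p τ * (1 + (t * spinSum m K τ) ^ 2 / 2 + (t * spinSum m K τ) ^ 4 / 24 + (K : ℝ) ^ 6 * Real.cosh 1 / 720 * t ^ 6) =
      1 + (∑ τ, p τ * spinSum m K τ ^ 2) * t ^ 2 / 2 + (∑ τ, p τ * spinSum m K τ ^ 4) * t ^ 4 / 24 +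
        (K : ℝ) ^ 6 * Real.cosh 1 / 720 * t ^ 6 := by
    have e : ∀ τ, p τ * (1 + (t * spinSum m K τ) ^ 2 / 2 + (t * spinSum m K τ) ^ 4 / 24 + (K : ℝ) ^ 6 * Real.cosh 1 / 720 * t ^ 6) =
        p τ + p τ * spinSum m K τ ^ 2 * (t ^ 2 / 2) + p τ * spinSum m K τ ^ 4 * (t ^ 4 / 24) +
          p τ * ((K : ℝ) ^ 6 * Real.cosh 1 / 720 * t ^ 6) := fun τ => by ring
    simp_rw [e]
    rw [Finset.sum_add_distrib, Finset.sum_add_distrib, Finset.sum_add_distrib, ← Finset.sum_mul, ← Finset.sum_mul,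
      ← Finset.sum_mul, hp1]
    ring
  linarith

/-- **`2 log M(t) ≥ u₂t² + (u₄/12)t⁴ - C_E t⁶`** for `|t| ≤ 1` (`u₄ = m₄ - 3u₂²`,
`C_E = u₂m₄/24 + m₄²/576`; from `M ≥ 1 + w`, `log(1+w) ≥ w - w²/2`). [folklore] -/
theorem expansion_le_two_log_mgfN (hp : ∀ τ, 0 < p τ) (hp1 : ∑ τ, p τ = 1) (ψ : Ω ≃ Ω)
    (hψp : ∀ τ, p (ψ τ) = p τ) (hψm : ∀ τ, m (ψ τ) + m τ = K) {t : ℝ} (ht1 : |t| ≤ 1) :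
    (∑ τ, p τ * spinSum m K τ ^ 2) * t ^ 2 +
        ((∑ τ, p τ * spinSum m K τ ^ 4) - 3 * (∑ τ, p τ * spinSum m K τ ^ 2) ^ 2) / 12 * t ^ 4 -
        ((∑ τ, p τ * spinSum m K τ ^ 2) * (∑ τ, p τ * spinSum m K τ ^ 4) / 24 +
          (∑ τ, p τ * spinSum m K τ ^ 4) ^ 2 / 576) * t ^ 6 ≤
      2 * Real.log (mgfN p m K t) := by
  set u₂ : ℝ := ∑ τ, p τ * spinSum m K τ ^ 2 with hu₂
  set m₄ : ℝ := ∑ τ, p τ * spinSum m K τ ^ 4 with hm₄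
  have hu₂0 : 0 ≤ u₂ := Finset.sum_nonneg fun τ _ => mul_nonneg (hp τ).le (sq_nonneg _)
  have hm₄0 : 0 ≤ m₄ := Finset.sum_nonneg fun τ _ => mul_nonneg (hp τ).le (by positivity)
  set w : ℝ := u₂ * t ^ 2 / 2 + m₄ * t ^ 4 / 24 with hw
  have hw0 : 0 ≤ w := by positivity
  have hM : 1 + w ≤ mgfN p m K t := by
    have := taylor_le_mgfN hp hp1 ψ hψp hψm t
    rw [hw]; linarith
  have hlog : Real.log (1 + w) ≤ Real.log (mgfN p m K t) := Real.log_le_log (by positivity) hM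
  have hlow := sub_sq_div_two_le_log_one_add hw0
  have ht2 : t ^ 2 ≤ 1 := by
    have h := abs_le.1 ht1
    nlinarith
  have ht8 : t ^ 8 ≤ t ^ 6 := by
    have h6 : 0 ≤ t ^ 6 := by positivity
    calc t ^ 8 = t ^ 6 * t ^ 2 := by ring
      _ ≤ t ^ 6 * 1 := mul_le_mul_of_nonneg_left ht2 h6
      _ = t ^ 6 := mul_one _
  have key : u₂ * t ^ 2 + (m₄ - 3 * u₂ ^ 2) / 12 * t ^ 4 - (u₂ * m₄ / 24 + m₄ ^ 2 / 576) * t ^ 6 ≤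
      2 * (w - w ^ 2 / 2) := by
    rw [hw]
    nlinarith [mul_le_mul_of_nonneg_left ht8 (sq_nonneg m₄)]
  linarith

/-- **`2 log M(t) ≤ u₂t² + C'_E t⁴`** for `|t| ≤ min(1, 1/(K+1))` (`log M ≤ M - 1`). [folklore] -/
theorem two_log_mgfN_le (hp : ∀ τ, 0 < p τ) (hp1 : ∑ τ, p τ = 1) (hmK : ∀ τ, m τ ≤ K) (ψ : Ω ≃ Ω)
    (hψp : ∀ τ, p (ψ τ) = p τ) (hψm : ∀ τ, m (ψ τ) + m τ = K) (τ₀ : Ω) {t : ℝ} (ht : |t| ≤ 1 / (K + 1))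
    (ht1 : |t| ≤ 1) :
    2 * Real.log (mgfN p m K t) ≤
      (∑ τ, p τ * spinSum m K τ ^ 2) * t ^ 2 +
        ((∑ τ, p τ * spinSum m K τ ^ 4) / 12 + 2 * ((K : ℝ) ^ 6 * Real.cosh 1 / 720)) * t ^ 4 := by
  set u₂ : ℝ := ∑ τ, p τ * spinSum m K τ ^ 2 with hu₂
  set m₄ : ℝ := ∑ τ, p τ * spinSum m K τ ^ 4 with hm₄
  set C₆ : ℝ := (K : ℝ) ^ 6 * Real.cosh 1 / 720 with hC₆
  have hC₆0 : 0 ≤ C₆ := by positivity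
  have hM := mgfN_le_taylor hp hp1 hmK ψ hψp hψm ht
  have hlog : Real.log (mgfN p m K t) ≤ mgfN p m K t - 1 := Real.log_le_sub_one_of_pos (mgfN_pos hp τ₀ t)
  have ht2 : t ^ 2 ≤ 1 := by
    have h := abs_le.1 ht1
    nlinarith
  have ht6 : t ^ 6 ≤ t ^ 4 := by
    have h4 : 0 ≤ t ^ 4 := by positivity
    calc t ^ 6 = t ^ 4 * t ^ 2 := by ring
      _ ≤ t ^ 4 * 1 := mul_le_mul_of_nonneg_left ht2 h4
      _ = t ^ 4 := mul_one _
  change mgfN p m K t ≤ 1 + u₂ * t ^ 2 / 2 + m₄ * t ^ 4 / 24 + C₆ * t ^ 6 at hM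
  nlinarith [mul_le_mul_of_nonneg_left ht6 hC₆0]

/-- **Newman's bounds for a lattice distribution with the Lee–Yang property.** For positive
weights `p` summing to `1` on a finite set, `N = 2m - K` with `m ≤ K`, `max m = K`, a
weight-preserving bijection reversing `m ↦ K - m`, and `∑ p_τ e^{zN_τ} ≠ 0` for `Re z > 0`:
`exp(u₂t²/2 + u₄t⁴/24 - u₂t⁴/6) ≤ M(t) ≤ exp(u₂t²/2)` for all real `t`, where `M(t) = ∑ p_τe^{tN_τ}`,
`u₂ = ∑ p N²`, `u₄ = ∑ pN⁴ - 3u₂²`. (Steps 2–3 of the module docstring; the extra `-u₂t⁴/6` is the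
price of unit lattice spacing and disappears under rescaling `N ↦ δN`, `δ → 0`.)
[cite: Newman1975, Theorem 4, eq. (2.5), k = 0 and 1 (lattice form)] -/
theorem newman_bounds_lattice (hp : ∀ τ, 0 < p τ) (hp1 : ∑ τ, p τ = 1) (hmK : ∀ τ, m τ ≤ K)
    (ψ : Ω ≃ Ω) (hψp : ∀ τ, p (ψ τ) = p τ) (hψm : ∀ τ, m (ψ τ) + m τ = K) {τ₁ : Ω} (h1 : m τ₁ = K)
    (hLY : ∀ z : ℂ, 0 < z.re → ∑ τ, (p τ : ℂ) * Complex.exp (z * (spinSum m K τ : ℂ)) ≠ 0) (t : ℝ) :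
    Real.exp ((∑ τ, p τ * spinSum m K τ ^ 2) * t ^ 2 / 2 +
          ((∑ τ, p τ * spinSum m K τ ^ 4) - 3 * (∑ τ, p τ * spinSum m K τ ^ 2) ^ 2) * t ^ 4 / 24 -
          (∑ τ, p τ * spinSum m K τ ^ 2) * t ^ 4 / 6) ≤ mgfN p m K t ∧
      mgfN p m K t ≤ Real.exp ((∑ τ, p τ * spinSum m K τ ^ 2) * t ^ 2 / 2) := by
  set u₂ : ℝ := ∑ τ, p τ * spinSum m K τ ^ 2 with hu₂
  set m₄ : ℝ := ∑ τ, p τ * spinSum m K τ ^ 4 with hm₄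
  -- an element with `m = 0`
  have h0 : m (ψ τ₁) = 0 := by have := hψm τ₁; omega
  set τ₀ := ψ τ₁ with hτ₀
  have hroots : ∀ u : ℂ, (genPoly p m).IsRoot u → ‖u‖ = 1 :=
    fun u hu => norm_eq_one_of_isRoot hp ψ hψp hψm h0 hLY hu
  -- the multiset of coefficients `b_r`
  set bs : Multiset ℝ := (genPoly p m).roots.map fun r => 2 / (1 - r.re) with hbs
  have hb1 : ∀ b ∈ bs, 1 ≤ b := fun b hb => one_le_coeff_of_mem_roots hp1 hroots hb
  have hprod : ∀ s : ℝ, mgfN p m K s ^ 2 = (bs.map fun b => 1 + b * Real.sinh s ^ 2).prod := by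
    intro s
    rw [mgfN_sq_eq_prod hp hp1 hmK τ₀ h1 hroots s, hbs, Multiset.map_map]
    rfl
  have hMpos : ∀ s, 0 < mgfN p m K s := mgfN_pos hp τ₀
  have h2log : ∀ s : ℝ, 2 * Real.log (mgfN p m K s) = Real.log (bs.map fun b => 1 + b * Real.sinh s ^ 2).prod := by
    intro s
    rw [← hprod, Real.log_pow, Nat.cast_ofNat]
  -- product-side bounds
  have hP1 : ∀ s : ℝ, bSum₁ bs * s ^ 2 - bSum₂ bs / 2 * s ^ 4 ≤ 2 * Real.log (mgfN p m K s) :=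
    fun s => (h2log s).symm ▸ bSum_le_log_prod hb1 s
  have hP2 : ∀ s : ℝ, 2 * Real.log (mgfN p m K s) ≤ bSum₁ bs * s ^ 2 :=
    fun s => (h2log s).symm ▸ log_prod_le_bSum₁ hb1 s
  have hP3 : ∀ s : ℝ, |s| ≤ 1 → 2 * Real.log (mgfN p m K s) ≤
      bSum₁ bs * s ^ 2 + (bSum₁ bs / 3 - bSum₂ bs / 2) * s ^ 4 + bRem bs * s ^ 6 :=
    fun s hs => (h2log s).symm ▸ log_prod_le_expansion hb1 hs
  -- moment-side bounds on `(0, ε)`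
  set ε : ℝ := min 1 (1 / (K + 1)) with hε
  have hε0 : 0 < ε := lt_min one_pos (by positivity)
  have hεle : ∀ s : ℝ, 0 < s → s < ε → |s| ≤ 1 ∧ |s| ≤ 1 / (K + 1) := fun s hs0 hsε => by
    rw [abs_of_pos hs0]
    exact ⟨(hsε.trans_le (min_le_left _ _)).le, (hsε.trans_le (min_le_right _ _)).le⟩
  set C₆ : ℝ := (K : ℝ) ^ 6 * Real.cosh 1 / 720 with hC₆
  set CE : ℝ := u₂ * m₄ / 24 + m₄ ^ 2 / 576 with hCE
  have hE1 : ∀ s : ℝ, 0 < s → s < ε →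
      u₂ * s ^ 2 + (m₄ - 3 * u₂ ^ 2) / 12 * s ^ 4 - CE * s ^ 6 ≤ 2 * Real.log (mgfN p m K s) :=
    fun s hs0 hsε => expansion_le_two_log_mgfN hp hp1 ψ hψp hψm (hεle s hs0 hsε).1
  have hE2 : ∀ s : ℝ, 0 < s → s < ε →
      2 * Real.log (mgfN p m K s) ≤ u₂ * s ^ 2 + (m₄ / 12 + 2 * C₆) * s ^ 4 :=
    fun s hs0 hsε => two_log_mgfN_le hp hp1 hmK ψ hψp hψm τ₀ (hεle s hs0 hsε).2 (hεle s hs0 hsε).1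
  -- comparison of the expansions
  have hA : bSum₁ bs - u₂ ≤ 0 := by
    refine (coeff_nonpos_of_expansion_le (β := -(bSum₂ bs / 2) - (m₄ / 12 + 2 * C₆)) (γ := 0) hε0
      fun s hs0 hsε => ?_).1
    have h1 := hP1 s
    have h2 := hE2 s hs0 hsε
    nlinarith
  have hB := coeff_nonpos_of_expansion_le (α := u₂ - bSum₁ bs)
    (β := (m₄ - 3 * u₂ ^ 2) / 12 - (bSum₁ bs / 3 - bSum₂ bs / 2)) (γ := CE + bRem bs) hε0
    fun s hs0 hsε => by
      have h1 := hE1 s hs0 hsε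
      have h2 := hP3 s (hεle s hs0 hsε).1
      nlinarith
  have hS₁ : bSum₁ bs = u₂ := by linarith [hB.1]
  have hS₂ : bSum₂ bs / 2 ≤ u₂ / 3 - (m₄ - 3 * u₂ ^ 2) / 12 := by
    have := hB.2 (by linarith)
    rw [hS₁] at this
    linarith
  -- conclusion
  have hlogM : Real.exp (Real.log (mgfN p m K t)) = mgfN p m K t := Real.exp_log (hMpos t)
  constructor
  · rw [← hlogM, Real.exp_le_exp]
    have h1 := hP1 t
    rw [hS₁] at h1
    have ht4 : 0 ≤ t ^ 4 := by positivity
    nlinarith [mul_le_mul_of_nonneg_right hS₂ ht4]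
  · rw [← hlogM, Real.exp_le_exp]
    have h2 := hP2 t
    rw [hS₁] at h2
    linarith

end Core

/-! ### Part E. The pair-interaction Ising model on a finite set: Lee–Yang, and Newman's bounds -/

section Ising

variable {ι : Type*} [Fintype ι] [DecidableEq ι]

/-- Bool coding of a `±1` spin: `[u = 1]`. [folklore] -/
def boolOfUnit (u : ℤˣ) : Bool := decide (u = 1)

/-- The `±1` spin coded by a Bool. [folklore] -/
def unitOfBool (b : Bool) : ℤˣ := if b then 1 else -1

/-- `unitOfBool ∘ boolOfUnit = id`. [folklore] -/
theorem unitOfBool_boolOfUnit (u : ℤˣ) : unitOfBool (boolOfUnit u) = u := by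
  rcases Int.units_eq_one_or u with rfl | rfl <;> decide

/-- `boolOfUnit ∘ unitOfBool = id`. [folklore] -/
theorem boolOfUnit_unitOfBool (b : Bool) : boolOfUnit (unitOfBool b) = b := by
  cases b <;> decide

/-- The complex number `[u = 1] ? 1 : -1` is the spin `u`. [folklore] -/
theorem ite_boolOfUnit (u : ℤˣ) : (if boolOfUnit u then (1 : ℂ) else -1) = ((u : ℤ) : ℂ) := by
  rcases Int.units_eq_one_or u with rfl | rfl <;> simp [boolOfUnit]

/-- `[u = 1] = [v = 1] ? 1 : -1` is the product `uv`. [folklore] -/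
theorem ite_boolOfUnit_eq (u v : ℤˣ) :
    (if boolOfUnit u = boolOfUnit v then (1 : ℂ) else -1) = ((u : ℤ) : ℂ) * ((v : ℤ) : ℂ) := by
  rcases Int.units_eq_one_or u with rfl | rfl <;> rcases Int.units_eq_one_or v with rfl | rfl <;>
    simp [boolOfUnit]

/-- Spin configurations on `ι` coded as Boolean vectors on `Fin |ι|`. [folklore] -/
def cfgEquiv {n : ℕ} (e : ι ≃ Fin n) : SpinConfig ι ≃ (Fin n → Bool) where
  toFun ρ i := boolOfUnit (ρ (e.symm i))
  invFun σ a := unitOfBool (σ (e a))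
  left_inv ρ := funext fun a => by simp [unitOfBool_boolOfUnit]
  right_inv σ := funext fun i => by simp [boolOfUnit_unitOfBool]

omit [Fintype ι] [DecidableEq ι] in
/-- Field term in the Bool coding. [folklore] -/
theorem ite_cfgEquiv {n : ℕ} (e : ι ≃ Fin n) (ρ : SpinConfig ι) (i : Fin n) :
    (if cfgEquiv e ρ i then (1 : ℂ) else -1) = ((ρ (e.symm i) : ℤ) : ℂ) :=
  ite_boolOfUnit _

omit [Fintype ι] [DecidableEq ι] in
/-- Pair term in the Bool coding. [folklore] -/
theorem ite_cfgEquiv_eq {n : ℕ} (e : ι ≃ Fin n) (ρ : SpinConfig ι) (i j : Fin n) :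
    (if cfgEquiv e ρ i = cfgEquiv e ρ j then (1 : ℂ) else -1) =
      ((ρ (e.symm i) : ℤ) : ℂ) * ((ρ (e.symm j) : ℤ) : ℂ) :=
  ite_boolOfUnit_eq _ _

/-- **Lee–Yang for the pair-interaction weights** (the tree's `lee_yang_circle_theorem_finite_holds`,
transported from `Fin n → Bool` to `SpinConfig ι`): for couplings `c ≥ 0` and complex fields with
`Re h_a > 0`, `∑_σ w_c(σ) exp(∑_a h_aσ_a) ≠ 0`. [cite: LeeYang1952, Appendix II] -/
theorem sum_weight_mul_exp_ne_zero (c : ι → ι → ℝ) (hc : ∀ a b, 0 ≤ c a b) (h : ι → ℂ)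
    (hh : ∀ a, 0 < (h a).re) :
    ∑ ρ : SpinConfig ι, (PairIsing.weight c ρ : ℂ) * Complex.exp (∑ a, h a * (spinAt a ρ : ℂ)) ≠ 0 := by
  set n := Fintype.card ι
  set e : ι ≃ Fin n := Fintype.equivFin ι with he
  have hLY := lee_yang_circle_theorem_finite_holds n (fun i j => c (e.symm i) (e.symm j)) (fun i => h (e.symm i))
    (fun i j => hc _ _) (fun i => hh _)
  have key : ∑ ρ : SpinConfig ι, (PairIsing.weight c ρ : ℂ) * Complex.exp (∑ a, h a * (spinAt a ρ : ℂ)) =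
      ∑ σ : Fin n → Bool, Complex.exp ((∑ i, ∑ j, ((c (e.symm i) (e.symm j) : ℝ) : ℂ) *
        (if σ i = σ j then 1 else -1)) + ∑ i, h (e.symm i) * (if σ i then 1 else -1)) := by
    refine Fintype.sum_equiv (cfgEquiv e) _ _ fun ρ => ?_
    rw [PairIsing.weight, Complex.ofReal_exp, ← Complex.exp_add]
    congr 1
    push_cast
    congr 1
    · rw [← Equiv.sum_comp e.symm]
      refine Finset.sum_congr rfl fun i _ => ?_
      rw [← Equiv.sum_comp e.symm]
      refine Finset.sum_congr rfl fun j _ => ?_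
      rw [ite_cfgEquiv_eq, spinAt, spinAt]
      push_cast
      ring
    · rw [← Equiv.sum_comp e.symm]
      refine Finset.sum_congr rfl fun i _ => ?_
      rw [ite_cfgEquiv, spinAt]
      push_cast
      ring
  rw [key]
  exact hLY

/-- **Newman's bounds for the pair-interaction Ising model, integer coefficients** (`c ≥ 0`,
`k_a ∈ ℕ_{≥1}`, `X = ∑ k_aσ_a`): `exp(u₂t²/2 + u₄t⁴/24 - u₂t⁴/6) ≤ ⟨e^{tX}⟩_c ≤ exp(u₂t²/2)` with
`u₂ = ⟨X²⟩_c`, `u₄ = ⟨X⁴⟩_c - 3u₂²` (`newman_bounds_lattice` for the Gibbs probabilities, `m = ∑_{σ_a=+1}k_a`,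
`K = ∑ k_a`, the flip `σ ↦ -σ`, and Lee–Yang). [cite: Newman1975, Theorem 4, eq. (2.5), k = 0 and 1 (lattice form)] -/
theorem avg_exp_bounds_nat (c : ι → ι → ℝ) (hc : ∀ a b, 0 ≤ c a b) (kk : ι → ℕ) (hkk : ∀ a, 1 ≤ kk a) (t : ℝ) :
    Real.exp (PairIsing.avg c (fun ρ => (∑ a, (kk a : ℝ) * spinAt a ρ) ^ 2) * t ^ 2 / 2 +
          (PairIsing.avg c (fun ρ => (∑ a, (kk a : ℝ) * spinAt a ρ) ^ 4) -
            3 * PairIsing.avg c (fun ρ => (∑ a, (kk a : ℝ) * spinAt a ρ) ^ 2) ^ 2) * t ^ 4 / 24 -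
          PairIsing.avg c (fun ρ => (∑ a, (kk a : ℝ) * spinAt a ρ) ^ 2) * t ^ 4 / 6) ≤
        PairIsing.avg c (fun ρ => Real.exp (t * ∑ a, (kk a : ℝ) * spinAt a ρ)) ∧
      PairIsing.avg c (fun ρ => Real.exp (t * ∑ a, (kk a : ℝ) * spinAt a ρ)) ≤
        Real.exp (PairIsing.avg c (fun ρ => (∑ a, (kk a : ℝ) * spinAt a ρ) ^ 2) * t ^ 2 / 2) := by
  -- the data of `newman_bounds_lattice`
  set Z : ℝ := ∑ ρ : SpinConfig ι, PairIsing.weight c ρ with hZ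
  have hZ0 : 0 < Z := PairIsing.sum_weight_pos c
  set p : SpinConfig ι → ℝ := fun ρ => PairIsing.weight c ρ / Z with hp
  set m : SpinConfig ι → ℕ := fun ρ => ∑ a, if ρ a = 1 then kk a else 0 with hm
  set K : ℕ := ∑ a, kk a with hK
  have hp0 : ∀ ρ, 0 < p ρ := fun ρ => div_pos (PairIsing.weight_pos c ρ) hZ0
  have hp1 : ∑ ρ, p ρ = 1 := by
    rw [hp]
    simp only [← Finset.sum_div]
    exact div_self hZ0.ne'
  have hmK : ∀ ρ, m ρ ≤ K := fun ρ => Finset.sum_le_sum fun a _ => by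
    split_ifs
    · exact le_rfl
    · exact Nat.zero_le _
  -- the flip
  set ψ : SpinConfig ι ≃ SpinConfig ι := Equiv.neg (SpinConfig ι) with hψ
  have hw : ∀ ρ : SpinConfig ι, PairIsing.weight c (-ρ) = PairIsing.weight c ρ := by
    intro ρ
    unfold PairIsing.weight
    congr 1
    refine Finset.sum_congr rfl fun a _ => Finset.sum_congr rfl fun b _ => ?_
    rw [spinAt_neg, spinAt_neg]
    ring
  have hψp : ∀ ρ, p (ψ ρ) = p ρ := by
    intro ρ
    simp only [hp, hψ, Equiv.neg_apply, hw]
  have hψm : ∀ ρ, m (ψ ρ) + m ρ = K := by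
    intro ρ
    simp only [hm, hψ, Equiv.neg_apply, hK, ← Finset.sum_add_distrib]
    refine Finset.sum_congr rfl fun a _ => ?_
    rcases Int.units_eq_one_or (ρ a) with h1 | h1
    · simp [h1, Pi.neg_apply]
    · simp [h1, Pi.neg_apply]
  have h1 : m (fun _ => 1) = K := by simp [hm, hK]
  -- `N = X`
  have hN : ∀ ρ, spinSum m K ρ = ∑ a, (kk a : ℝ) * spinAt a ρ := by
    intro ρ
    simp only [spinSum, hm, hK]
    push_cast
    rw [Finset.mul_sum, ← Finset.sum_sub_distrib]
    refine Finset.sum_congr rfl fun a _ => ?_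
    rcases Int.units_eq_one_or (ρ a) with h1 | h1
    · simp only [h1, if_true, spinAt, Units.val_one, Int.cast_one, mul_one]
      ring
    · simp [h1, spinAt]
  -- expectations
  have havg : ∀ F : ℝ → ℝ, ∑ ρ, p ρ * F (spinSum m K ρ) =
      PairIsing.avg c (fun ρ => F (∑ a, (kk a : ℝ) * spinAt a ρ)) := by
    intro F
    rw [PairIsing.avg, Finset.sum_div]
    refine Finset.sum_congr rfl fun ρ _ => ?_
    rw [hN, hp]
    ring
  have hM : mgfN p m K t = PairIsing.avg c (fun ρ => Real.exp (t * ∑ a, (kk a : ℝ) * spinAt a ρ)) := by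
    rw [mgfN]; exact havg fun s => Real.exp (t * s)
  have hu₂ : ∑ ρ, p ρ * spinSum m K ρ ^ 2 = PairIsing.avg c (fun ρ => (∑ a, (kk a : ℝ) * spinAt a ρ) ^ 2) :=
    havg fun s => s ^ 2
  have hm₄ : ∑ ρ, p ρ * spinSum m K ρ ^ 4 = PairIsing.avg c (fun ρ => (∑ a, (kk a : ℝ) * spinAt a ρ) ^ 4) :=
    havg fun s => s ^ 4
  -- Lee–Yang
  have hLY : ∀ z : ℂ, 0 < z.re → ∑ ρ, (p ρ : ℂ) * Complex.exp (z * (spinSum m K ρ : ℂ)) ≠ 0 := by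
    intro z hz
    have hne := sum_weight_mul_exp_ne_zero c hc (fun a => z * kk a) fun a => by
      simp only [Complex.mul_re, Complex.natCast_re, Complex.natCast_im, mul_zero, sub_zero]
      exact mul_pos hz (by exact_mod_cast hkk a)
    have heq : ∑ ρ, (p ρ : ℂ) * Complex.exp (z * (spinSum m K ρ : ℂ)) =
        (Z : ℂ)⁻¹ * ∑ ρ : SpinConfig ι, (PairIsing.weight c ρ : ℂ) * Complex.exp (∑ a, z * kk a * (spinAt a ρ : ℂ)) := by
      rw [Finset.mul_sum]
      refine Finset.sum_congr rfl fun ρ _ => ?_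
      rw [hp, hN]
      push_cast
      rw [Finset.mul_sum]
      have e : ∑ a, (z * ((kk a : ℂ) * (spinAt a ρ : ℂ))) = ∑ a, z * kk a * (spinAt a ρ : ℂ) :=
        Finset.sum_congr rfl fun a _ => by ring
      rw [e]
      ring
    rw [heq]
    exact mul_ne_zero (inv_ne_zero (Complex.ofReal_ne_zero.2 hZ0.ne')) hne
  have key := newman_bounds_lattice hp0 hp1 hmK ψ hψp hψm h1 hLY t
  rw [hM, hu₂, hm₄] at key
  exact key

/-- Rational approximation from above of a non-negative real by `(⌊(k+1)g⌋+1)/(k+1)`: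
`g < g_k ≤ g + 1/(k+1)`. [folklore] -/
theorem approx_bounds {g : ℝ} (hg : 0 ≤ g) (k : ℕ) :
    g < ((⌊((k : ℝ) + 1) * g⌋₊ + 1 : ℕ) : ℝ) / ((k : ℝ) + 1) ∧
      ((⌊((k : ℝ) + 1) * g⌋₊ + 1 : ℕ) : ℝ) / ((k : ℝ) + 1) ≤ g + 1 / ((k : ℝ) + 1) := by
  have hk : (0 : ℝ) < k + 1 := by positivity
  have hx : 0 ≤ ((k : ℝ) + 1) * g := by positivity
  have h1 := Nat.floor_le hx
  have h2 := Nat.lt_floor_add_one (((k : ℝ) + 1) * g)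
  push_cast
  constructor
  · rw [lt_div_iff₀ hk]; linarith
  · rw [div_le_iff₀ hk]
    have : (g + 1 / ((k : ℝ) + 1)) * ((k : ℝ) + 1) = ((k : ℝ) + 1) * g + 1 := by field_simp
    rw [this]; linarith

/-- The approximations converge. [folklore] -/
theorem tendsto_approx {g : ℝ} (hg : 0 ≤ g) :
    Tendsto (fun k : ℕ => ((⌊((k : ℝ) + 1) * g⌋₊ + 1 : ℕ) : ℝ) / ((k : ℝ) + 1)) atTop (𝓝 g) := by
  have hup : Tendsto (fun k : ℕ => g + 1 / ((k : ℝ) + 1)) atTop (𝓝 g) := by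
    have h := (tendsto_const_nhds (x := g)).add (tendsto_one_div_add_atTop_nhds_zero_nat (𝕜 := ℝ))
    rwa [add_zero] at h
  exact tendsto_of_tendsto_of_tendsto_of_le_of_le tendsto_const_nhds hup
    (fun k => (approx_bounds hg k).1.le) fun k => (approx_bounds hg k).2

/-- Gibbs averages of a continuous function of `∑ g_aσ_a` depend continuously on the coefficients
(along a sequence). [folklore] -/
theorem tendsto_avg_comp (c : ι → ι → ℝ) {g : ι → ℝ} {gs : ℕ → ι → ℝ}
    (hgs : ∀ a, Tendsto (fun k => gs k a) atTop (𝓝 (g a))) {G : ℝ → ℝ} (hG : Continuous G) :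
    Tendsto (fun k : ℕ => PairIsing.avg c (fun ρ => G (∑ a, gs k a * spinAt a ρ))) atTop
      (𝓝 (PairIsing.avg c (fun ρ => G (∑ a, g a * spinAt a ρ)))) := by
  simp only [PairIsing.avg]
  refine Tendsto.div_const (tendsto_finsetSum _ fun ρ _ => Tendsto.mul_const _ ?_) _
  refine (hG.tendsto _).comp (tendsto_finsetSum _ fun a _ => ?_)
  exact (hgs a).mul_const _

/-- **Newman's bounds for the pair-interaction Ising model on a finite set** (Newman 1975, Theorem 4,
eq. (2.5), `k = 0, 1`; `c ≥ 0`, real coefficients `g ≥ 0`, `Y = ∑ g_aσ_a`):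
`exp(u₂t²/2 + u₄t⁴/24) ≤ ⟨e^{tY}⟩_c ≤ exp(u₂t²/2)`, `u₂ = ⟨Y²⟩_c`, `u₄ = ⟨Y⁴⟩_c - 3u₂²` — the
integer case rescaled by `1/(k+1)` and the limit `k → ∞`. [cite: Newman1975, Theorem 4, eq. (2.5), k = 0 and 1] -/
theorem avg_exp_bounds (c : ι → ι → ℝ) (hc : ∀ a b, 0 ≤ c a b) (g : ι → ℝ) (hg : ∀ a, 0 ≤ g a) (t : ℝ) :
    Real.exp (PairIsing.avg c (fun ρ => (∑ a, g a * spinAt a ρ) ^ 2) * t ^ 2 / 2 +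
          (PairIsing.avg c (fun ρ => (∑ a, g a * spinAt a ρ) ^ 4) -
            3 * PairIsing.avg c (fun ρ => (∑ a, g a * spinAt a ρ) ^ 2) ^ 2) * t ^ 4 / 24) ≤
        PairIsing.avg c (fun ρ => Real.exp (t * ∑ a, g a * spinAt a ρ)) ∧
      PairIsing.avg c (fun ρ => Real.exp (t * ∑ a, g a * spinAt a ρ)) ≤
        Real.exp (PairIsing.avg c (fun ρ => (∑ a, g a * spinAt a ρ) ^ 2) * t ^ 2 / 2) := by
  -- the approximating coefficients
  set kk : ℕ → ι → ℕ := fun k a => ⌊((k : ℝ) + 1) * g a⌋₊ + 1 with hkk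
  set gs : ℕ → ι → ℝ := fun k a => ((kk k a : ℕ) : ℝ) / ((k : ℝ) + 1) with hgs
  set A : ℕ → ℝ := fun k => PairIsing.avg c (fun ρ => (∑ a, gs k a * spinAt a ρ) ^ 2) with hA
  set B : ℕ → ℝ := fun k => PairIsing.avg c (fun ρ => (∑ a, gs k a * spinAt a ρ) ^ 4) with hB
  set E : ℕ → ℝ := fun k => PairIsing.avg c (fun ρ => Real.exp (t * ∑ a, gs k a * spinAt a ρ)) with hE
  -- the bounds along the sequence
  have hstep : ∀ k : ℕ, Real.exp (A k * t ^ 2 / 2 + (B k - 3 * A k ^ 2) * t ^ 4 / 24 - A k * t ^ 4 / (6 * ((k : ℝ) + 1) ^ 2)) ≤ E k ∧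
      E k ≤ Real.exp (A k * t ^ 2 / 2) := by
    intro k
    have hK : (0 : ℝ) < k + 1 := by positivity
    have h := avg_exp_bounds_nat c hc (kk k) (fun a => Nat.le_add_left 1 _) (t / ((k : ℝ) + 1))
    -- `∑ k_aσ_a = (k+1) ∑ g_aσ_a`
    have hX : ∀ ρ : SpinConfig ι, ∑ a, ((kk k a : ℕ) : ℝ) * spinAt a ρ = ((k : ℝ) + 1) * ∑ a, gs k a * spinAt a ρ := by
      intro ρ
      rw [Finset.mul_sum]
      refine Finset.sum_congr rfl fun a _ => ?_
      rw [hgs]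
      field_simp
    have h2 : PairIsing.avg c (fun ρ => (∑ a, ((kk k a : ℕ) : ℝ) * spinAt a ρ) ^ 2) = ((k : ℝ) + 1) ^ 2 * A k := by
      rw [hA, ← PairIsing.avg_const_mul]
      congr 1; funext ρ; rw [hX]; ring
    have h4 : PairIsing.avg c (fun ρ => (∑ a, ((kk k a : ℕ) : ℝ) * spinAt a ρ) ^ 4) = ((k : ℝ) + 1) ^ 4 * B k := by
      rw [hB, ← PairIsing.avg_const_mul]
      congr 1; funext ρ; rw [hX]; ring
    have hEk : PairIsing.avg c (fun ρ => Real.exp (t / ((k : ℝ) + 1) * ∑ a, ((kk k a : ℕ) : ℝ) * spinAt a ρ)) = E k := by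
      rw [hE]
      congr 1; funext ρ; rw [hX]; congr 1; field_simp
    rw [h2, h4, hEk] at h
    have e1 : ((k : ℝ) + 1) ^ 2 * A k * (t / ((k : ℝ) + 1)) ^ 2 / 2 +
        (((k : ℝ) + 1) ^ 4 * B k - 3 * (((k : ℝ) + 1) ^ 2 * A k) ^ 2) * (t / ((k : ℝ) + 1)) ^ 4 / 24 -
        ((k : ℝ) + 1) ^ 2 * A k * (t / ((k : ℝ) + 1)) ^ 4 / 6 =
        A k * t ^ 2 / 2 + (B k - 3 * A k ^ 2) * t ^ 4 / 24 - A k * t ^ 4 / (6 * ((k : ℝ) + 1) ^ 2) := by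
      field_simp
    have e2 : ((k : ℝ) + 1) ^ 2 * A k * (t / ((k : ℝ) + 1)) ^ 2 / 2 = A k * t ^ 2 / 2 := by
      field_simp
    rw [e1, e2] at h
    exact h
  -- limits
  have hgs_t : ∀ a, Tendsto (fun k => gs k a) atTop (𝓝 (g a)) := fun a => tendsto_approx (hg a)
  have hA' : Tendsto A atTop (𝓝 (PairIsing.avg c (fun ρ => (∑ a, g a * spinAt a ρ) ^ 2))) :=
    tendsto_avg_comp c hgs_t (G := fun s => s ^ 2) (continuous_pow 2)
  have hB' : Tendsto B atTop (𝓝 (PairIsing.avg c (fun ρ => (∑ a, g a * spinAt a ρ) ^ 4))) :=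
    tendsto_avg_comp c hgs_t (G := fun s => s ^ 4) (continuous_pow 4)
  have hE' : Tendsto E atTop (𝓝 (PairIsing.avg c (fun ρ => Real.exp (t * ∑ a, g a * spinAt a ρ)))) :=
    tendsto_avg_comp c hgs_t (G := fun s => Real.exp (t * s)) (by fun_prop)
  have herr : Tendsto (fun k : ℕ => A k * t ^ 4 / (6 * ((k : ℝ) + 1) ^ 2)) atTop (𝓝 0) := by
    have h1 : Tendsto (fun k : ℕ => (1 / ((k : ℝ) + 1)) ^ 2) atTop (𝓝 0) := by
      have h := (tendsto_one_div_add_atTop_nhds_zero_nat (𝕜 := ℝ)).pow 2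
      rwa [zero_pow two_ne_zero] at h
    have h2 := (hA'.mul_const (t ^ 4 / 6)).mul h1
    rw [mul_zero] at h2
    refine h2.congr fun k => ?_
    field_simp
  constructor
  · refine le_of_tendsto_of_tendsto ?_ hE' (Eventually.of_forall fun k => (hstep k).1)
    have h := ((((hA'.mul_const (t ^ 2)).div_const 2).add
      (((hB'.sub ((hA'.pow 2).const_mul 3)).mul_const (t ^ 4)).div_const 24)).sub herr)
    rw [sub_zero] at h
    exact (Real.continuous_exp.tendsto _).comp h
  · refine le_of_tendsto_of_tendsto hE' ?_ (Eventually.of_forall fun k => (hstep k).2)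
    exact (Real.continuous_exp.tendsto _).comp ((hA'.mul_const (t ^ 2)).div_const 2)

end Ising

end NewmanLeeYang

/-! ### Newman's Theorem 4 for the finite-volume states of `LongRangeTrivialityOnZ3` -/

namespace LongRangeIsing

variable {d : ℕ}

/-- **Newman 1975, Theorem 4, eq. (2.5) (`k = 0` and `k = 1`) for `⟨·⟩_{Λ,J,0,β}`, proved**: for a
pair interaction `J ≥ 0` on `ℤ^d`, `β ≥ 0`, a finite `Λ` and `X = ∑_{x∈Λ} λ_xσ_x` with `λ ≥ 0`,
`exp(u₂r²/2 + u₄r⁴/24) ≤ ⟨e^{rX}⟩_{Λ,J,0,β} ≤ exp(u₂r²/2)` with `u₂ = ⟨X²⟩`, `u₄ = ⟨X⁴⟩ - 3⟨X²⟩²`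
(`NewmanLeeYang.avg_exp_bounds` for the couplings `(β/2)J_{a,b} ≥ 0` on `↥Λ`, through
`expectIn_zero_eq_avg`). The upper bound is also the tree's `expectIn_exp_mul_le_of_ghs` (GHS route).
[cite: Newman1975, Theorem 4, eq. (2.5) (k = 0, 1), with Theorem 1 and §2] -/
theorem newman_mgf_bounds (J : Site d → Site d → ℝ) (hJ : ∀ x y, 0 ≤ J x y) {β : ℝ} (hβ : 0 ≤ β)
    (Λ : Finset (Site d)) {lam : Site d → ℝ} (hlam : ∀ x, 0 ≤ lam x) (r : ℝ) :
    Real.exp (expectIn J Λ β 0 (fun σ => (∑ x ∈ Λ, lam x * spinAt x σ) ^ 2) * r ^ 2 / 2 +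
          (expectIn J Λ β 0 (fun σ => (∑ x ∈ Λ, lam x * spinAt x σ) ^ 4) -
            3 * expectIn J Λ β 0 (fun σ => (∑ x ∈ Λ, lam x * spinAt x σ) ^ 2) ^ 2) * r ^ 4 / 24) ≤
        expectIn J Λ β 0 (fun σ => Real.exp (r * ∑ x ∈ Λ, lam x * spinAt x σ)) ∧
      expectIn J Λ β 0 (fun σ => Real.exp (r * ∑ x ∈ Λ, lam x * spinAt x σ)) ≤
        Real.exp (expectIn J Λ β 0 (fun σ => (∑ x ∈ Λ, lam x * spinAt x σ) ^ 2) * r ^ 2 / 2) := by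
  set c : ↥Λ → ↥Λ → ℝ := fun a b => β / 2 * J a b with hc
  have hc0 : ∀ a b : ↥Λ, 0 ≤ c a b := fun a b => mul_nonneg (div_nonneg hβ zero_le_two) (hJ _ _)
  -- the observable on `Λ`-configurations
  have hglue : ∀ τ : SpinConfig ↥Λ, ∑ x ∈ Λ, lam x * spinAt x (glue Λ τ .free) = ∑ a : ↥Λ, lam a * spinAt a τ := by
    intro τ
    rw [← Finset.sum_coe_sort Λ]
    refine Finset.sum_congr rfl fun a _ => ?_
    rw [spinAt_glue_coe]
  have hE : ∀ G : ℝ → ℝ, expectIn J Λ β 0 (fun σ => G (∑ x ∈ Λ, lam x * spinAt x σ)) =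
      PairIsing.avg c (fun τ => G (∑ a : ↥Λ, lam a * spinAt a τ)) := by
    intro G
    rw [expectIn_zero_eq_avg]
    congr 1
    funext τ
    rw [hglue]
  have h := NewmanLeeYang.avg_exp_bounds c hc0 (fun a : ↥Λ => lam a) (fun a => hlam _) r
  rw [hE (fun s => s ^ 2), hE (fun s => s ^ 4), hE (fun s => Real.exp (r * s))]
  exact h

end LongRangeIsing

/-! ## Panis's moment-generating-function display, discharged -/

namespace LongRangeIsing

variable {d : ℕ}

/-! ### Finite volume: moments of a linear observable as smeared correlation functions -/

section Moments

variable (J : Site d → Site d → ℝ) (Λ : Finset (Site d)) (β : ℝ) (lam : Site d → ℝ)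

/-- `⟨(∑_{x∈Λ} λ_xσ_x)^k⟩_Λ = ∑_{x ∈ Λ^k} (∏ᵢ λ_{xᵢ}) ⟨∏ᵢ σ_{xᵢ}⟩_Λ` (multinomial expansion and
linearity). [folklore] -/
theorem expectIn_linear_pow (k : ℕ) :
    expectIn J Λ β 0 (fun σ => (∑ x ∈ Λ, lam x * spinAt x σ) ^ k) =
      ∑ p ∈ Fintype.piFinset (fun _ : Fin k => Λ),
        (∏ i, lam (p i)) * expectIn J Λ β 0 (fun σ => ∏ i, spinAt (p i) σ) := by
  have hexp : (fun σ : SpinConfig (Site d) => (∑ x ∈ Λ, lam x * spinAt x σ) ^ k) =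
      fun σ => ∑ p ∈ Fintype.piFinset (fun _ : Fin k => Λ),
        (∏ i, lam (p i)) * ∏ i, spinAt (p i) σ := by
    funext σ
    rw [Finset.sum_pow']
    refine Finset.sum_congr rfl fun p _ => ?_
    rw [Finset.prod_mul_distrib]
  rw [hexp, expectIn_finset_sum]
  refine Finset.sum_congr rfl fun p _ => ?_
  rw [expectIn_const_mul]

/-- The second moment as a smeared two-point function:
`⟨(∑ λ_xσ_x)²⟩_Λ = ∑_{a,b∈Λ} λ_aλ_b ⟨σ_aσ_b⟩_Λ`. [folklore] -/
theorem expectIn_linear_sq :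
    expectIn J Λ β 0 (fun σ => (∑ x ∈ Λ, lam x * spinAt x σ) ^ 2) =
      ∑ a ∈ Λ, ∑ b ∈ Λ, lam a * lam b * expectIn J Λ β 0 (fun σ => spinAt a σ * spinAt b σ) := by
  rw [expectIn_linear_pow, sum_piFinset_fin_two]
  refine Finset.sum_congr rfl fun a _ => Finset.sum_congr rfl fun b _ => ?_
  simp [Fin.prod_univ_two]

/-- **The deviation of the even moments from Wick's law as a smeared sum** (finite volume):
`⟨X^{2n}⟩ - (2n)!/(2ⁿn!) ⟨X²⟩ⁿ = ∑_{x∈Λ^{2n}} ∏λ_{xᵢ} (S_{2n}(x) - 𝒢_n[S₂](x))`, `X = ∑ λ_xσ_x`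
(the step between the pointwise inequality and the moment inequality; `sum_prod_mul_pairingSum`).
[cite: Panis2023Triviality, proof of Theorem 5.5, first display (p. 21)] -/
theorem expectIn_linear_pow_sub_wick (n : ℕ) :
    expectIn J Λ β 0 (fun σ => (∑ x ∈ Λ, lam x * spinAt x σ) ^ (2 * n)) -
        ((2 * n)! : ℝ) / (2 ^ n * n !) *
          expectIn J Λ β 0 (fun σ => (∑ x ∈ Λ, lam x * spinAt x σ) ^ 2) ^ n =
      ∑ p ∈ Fintype.piFinset (fun _ : Fin (2 * n) => Λ),
        (∏ i, lam (p i)) *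
          (expectIn J Λ β 0 (fun σ => ∏ i, spinAt (p i) σ) -
            pairingSum (fun a b => expectIn J Λ β 0 (fun σ => spinAt a σ * spinAt b σ)) n p) := by
  rw [expectIn_linear_pow, expectIn_linear_sq]
  simp_rw [mul_sub]
  rw [Finset.sum_sub_distrib,
    sum_prod_mul_pairingSum Λ lam (fun a b => expectIn J Λ β 0 (fun σ => spinAt a σ * spinAt b σ)) n]

end Moments

/-! ### Step 1: absolute values inside — the deviation of the moments of `X_λ` is at most the
(non-negative) Wick deficit of `X_{|λ|}` -/

section Deviation

variable {J : Site d → Site d → ℝ} {β : ℝ}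

/-- **Pointwise Gaussian inequality (the tree's `corrIn_le_pairingSum`) ⟹ moment bound with
absolute values inside.** For
`X = ∑_{x∈Λ} λ_xσ_x` and `Y = ∑_{x∈Λ} |λ_x|σ_x`:
`|⟨X^{2n}⟩ - (2n-1)!!⟨X²⟩ⁿ| ≤ (2n-1)!!⟨Y²⟩ⁿ - ⟨Y^{2n}⟩` (multiply `0 ≤ 𝒢_n - S_{2n}` by
`∏|λ_{xᵢ}| ≥ ± ∏λ_{xᵢ}` and sum). [cite: Newman1975Gaussian, Theorem 3, eq. (3.7)] -/
theorem abs_expectIn_pow_sub_wick_le (hJ : ∀ x y, 0 ≤ J x y)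
    (hβ : 0 ≤ β) (Λ : Finset (Site d)) (lam : Site d → ℝ) (n : ℕ) :
    |expectIn J Λ β 0 (fun σ => (∑ x ∈ Λ, lam x * spinAt x σ) ^ (2 * n)) -
        ((2 * n)! : ℝ) / (2 ^ n * n !) *
          expectIn J Λ β 0 (fun σ => (∑ x ∈ Λ, lam x * spinAt x σ) ^ 2) ^ n| ≤
      ((2 * n)! : ℝ) / (2 ^ n * n !) *
          expectIn J Λ β 0 (fun σ => (∑ x ∈ Λ, |lam x| * spinAt x σ) ^ 2) ^ n -
        expectIn J Λ β 0 (fun σ => (∑ x ∈ Λ, |lam x| * spinAt x σ) ^ (2 * n)) := by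
  set S₂ : Site d → Site d → ℝ := fun a b => expectIn J Λ β 0 (fun σ => spinAt a σ * spinAt b σ) with hS₂
  set D : (Fin (2 * n) → Site d) → ℝ := fun p =>
    expectIn J Λ β 0 (fun σ => ∏ i, spinAt (p i) σ) - pairingSum S₂ n p with hD
  have hDle : ∀ p ∈ Fintype.piFinset (fun _ : Fin (2 * n) => Λ), D p ≤ 0 := by
    intro p hp
    rw [Fintype.mem_piFinset] at hp
    have h := corrIn_le_pairingSum J Λ β hJ hβ p hp
    rw [corrIn] at h
    exact sub_nonpos.2 h
  have h1 := expectIn_linear_pow_sub_wick J Λ β lam n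
  have h2 := expectIn_linear_pow_sub_wick J Λ β (fun x => |lam x|) n
  rw [h1, ← neg_sub, h2, ← Finset.sum_neg_distrib]
  refine (Finset.abs_sum_le_sum_abs _ _).trans (Finset.sum_le_sum fun p hp => ?_)
  rw [abs_mul, Finset.abs_prod, ← mul_neg]
  exact mul_le_mul_of_nonneg_left (by rw [abs_of_nonpos (hDle p hp)])
    (Finset.prod_nonneg fun i _ => abs_nonneg _)

end Deviation

/-! ### Step 2: summation over `n` in finite volume -/

section Summation

variable (J : Site d → Site d → ℝ) (Λ : Finset (Site d)) (β : ℝ)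

/-- A finite-volume expectation is a finite weighted sum, so series may be exchanged with it: if
`HasSum (c n · F n σ) (G σ)` for every configuration, then `HasSum (c n ⟨F n⟩_Λ) ⟨G⟩_Λ`. [folklore] -/
theorem hasSum_expectIn {c : ℕ → ℝ} {F : ℕ → SpinConfig (Site d) → ℝ} {G : SpinConfig (Site d) → ℝ}
    (h : ∀ σ, HasSum (fun n => c n * F n σ) (G σ)) :
    HasSum (fun n => c n * expectIn J Λ β 0 (F n)) (expectIn J Λ β 0 G) := by
  unfold expectIn
  have key : HasSum (fun n => (∑ τ : ↥Λ → ℤˣ, c n * F n (glue Λ τ .free) * pairGibbsWeight J Λ β 0 τ) /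
      ∑ τ : ↥Λ → ℤˣ, pairGibbsWeight J Λ β 0 τ)
      ((∑ τ : ↥Λ → ℤˣ, G (glue Λ τ .free) * pairGibbsWeight J Λ β 0 τ) /
        ∑ τ : ↥Λ → ℤˣ, pairGibbsWeight J Λ β 0 τ) := by
    refine HasSum.div_const ?_ _
    refine hasSum_sum fun τ _ => ?_
    simpa only [mul_assoc] using (h (glue Λ τ .free)).mul_right (pairGibbsWeight J Λ β 0 τ)
  refine key.congr_fun fun n => ?_
  rw [← mul_div_assoc, Finset.mul_sum]
  refine congrArg (· / _) (Finset.sum_congr rfl fun τ _ => ?_)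
  ring

/-- **The even-moment series of the moment generating function** (finite volume, zero field):
`∑_n z^{2n}⟨X^{2n}⟩_Λ/(2n)! = ⟨exp(zX)⟩_Λ` for `X = ∑_{x∈Λ} λ_xσ_x` (the `cosh` series, and
`⟨sinh(zX)⟩_Λ = 0` by flip symmetry). [folklore] -/
theorem hasSum_expectIn_linear_pow (lam : Site d → ℝ) (z : ℝ) :
    HasSum (fun n : ℕ => z ^ (2 * n) / (2 * n)! *
        expectIn J Λ β 0 (fun σ => (∑ x ∈ Λ, lam x * spinAt x σ) ^ (2 * n)))
      (expectIn J Λ β 0 (fun σ => Real.exp (z * ∑ x ∈ Λ, lam x * spinAt x σ))) := by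
  set X : SpinConfig (Site d) → ℝ := fun σ => ∑ x ∈ Λ, lam x * spinAt x σ with hX
  -- flip symmetry: `⟨sinh(zX)⟩ = 0`
  have hflip : ∀ τ : SpinConfig ↥Λ, X (glue Λ (-τ) .free) = -X (glue Λ τ .free) := by
    intro τ
    simp only [hX, ← Finset.sum_neg_distrib]
    refine Finset.sum_congr rfl fun x hx => ?_
    rw [spinAt_glue_neg_of_mem τ hx]
    ring
  have hsinh : expectIn J Λ β 0 (fun σ => Real.sinh (z * X σ)) = 0 := by
    apply expectIn_eq_zero_of_odd
    intro τ
    rw [hflip, mul_neg, Real.sinh_neg]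
  have hexp : expectIn J Λ β 0 (fun σ => Real.exp (z * X σ)) =
      expectIn J Λ β 0 (fun σ => Real.cosh (z * X σ)) := by
    have : (fun σ => Real.exp (z * X σ)) = fun σ => Real.cosh (z * X σ) + Real.sinh (z * X σ) :=
      funext fun σ => (Real.cosh_add_sinh _).symm
    rw [this, expectIn_add, hsinh, add_zero]
  rw [hexp]
  refine hasSum_expectIn J Λ β fun σ => ?_
  have h := Real.hasSum_cosh (z * X σ)
  refine h.congr_fun fun n => ?_
  rw [mul_pow, mul_div_right_comm]

/-- The Gaussian series `∑_n z^{2n}(2n)!/((2n)! 2ⁿ n!) Vⁿ = exp(z²V/2)`. [folklore] -/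
theorem hasSum_wick_exp (V z : ℝ) :
    HasSum (fun n : ℕ => z ^ (2 * n) / (2 * n)! * (((2 * n)! : ℝ) / (2 ^ n * n !) * V ^ n))
      (Real.exp (z ^ 2 / 2 * V)) := by
  have hterm : ∀ n : ℕ, z ^ (2 * n) / (2 * n)! * (((2 * n)! : ℝ) / (2 ^ n * n !) * V ^ n) =
      (z ^ 2 / 2 * V) ^ n / n ! := fun n => by
    have hn : ((2 * n)! : ℝ) ≠ 0 := by positivity
    rw [pow_mul, show z ^ 2 / 2 * V = z ^ 2 * V / 2 by ring, div_pow, mul_pow]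
    field_simp
  simp_rw [hterm]
  rw [Real.exp_eq_exp_ℝ]
  exact NormedSpace.expSeries_div_hasSum_exp _

/-- **Summation of the moment bounds** (the "multiplying by `z^{2n}/(2n)!` and summing" of Panis
p. 21 / ADC §6.3, here with the two-sided Wick deficit): by the pointwise Gaussian inequality,
for `X = ∑ λ_xσ_x`, `Y = ∑ |λ_x|σ_x` and every real `z`,
`|⟨e^{zX}⟩_Λ - e^{z²⟨X²⟩/2}| ≤ e^{z²⟨Y²⟩/2} - ⟨e^{zY}⟩_Λ` (PROVED, no hypotheses beyond `J, β ≥ 0`).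
[cite: Panis2023Triviality, proof of Theorem 5.5, second display (p. 21)] -/
theorem abs_expectIn_exp_sub_exp_le (hJ : ∀ x y, 0 ≤ J x y)
    (hβ : 0 ≤ β) (lam : Site d → ℝ) (z : ℝ) :
    |expectIn J Λ β 0 (fun σ => Real.exp (z * ∑ x ∈ Λ, lam x * spinAt x σ)) -
        Real.exp (z ^ 2 / 2 * expectIn J Λ β 0 (fun σ => (∑ x ∈ Λ, lam x * spinAt x σ) ^ 2))| ≤
      Real.exp (z ^ 2 / 2 * expectIn J Λ β 0 (fun σ => (∑ x ∈ Λ, |lam x| * spinAt x σ) ^ 2)) -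
        expectIn J Λ β 0 (fun σ => Real.exp (z * ∑ x ∈ Λ, |lam x| * spinAt x σ)) := by
  set mX : ℕ → ℝ := fun k => expectIn J Λ β 0 (fun σ => (∑ x ∈ Λ, lam x * spinAt x σ) ^ k) with hmX
  set mY : ℕ → ℝ := fun k => expectIn J Λ β 0 (fun σ => (∑ x ∈ Λ, |lam x| * spinAt x σ) ^ k) with hmY
  set c : ℕ → ℝ := fun n => ((2 * n)! : ℝ) / (2 ^ n * n !) with hc
  -- the two difference series
  have hA : HasSum (fun n : ℕ => z ^ (2 * n) / (2 * n)! * (mX (2 * n) - c n * mX 2 ^ n))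
      (expectIn J Λ β 0 (fun σ => Real.exp (z * ∑ x ∈ Λ, lam x * spinAt x σ)) -
        Real.exp (z ^ 2 / 2 * mX 2)) := by
    have h := (hasSum_expectIn_linear_pow J Λ β lam z).sub (hasSum_wick_exp (mX 2) z)
    simpa only [← mul_sub] using h
  have hB : HasSum (fun n : ℕ => z ^ (2 * n) / (2 * n)! * (c n * mY 2 ^ n - mY (2 * n)))
      (Real.exp (z ^ 2 / 2 * mY 2) -
        expectIn J Λ β 0 (fun σ => Real.exp (z * ∑ x ∈ Λ, |lam x| * spinAt x σ))) := by
    have h := (hasSum_wick_exp (mY 2) z).sub (hasSum_expectIn_linear_pow J Λ β (fun x => |lam x|) z)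
    simpa only [← mul_sub] using h
  -- termwise comparison
  have hz : ∀ n : ℕ, 0 ≤ z ^ (2 * n) / (2 * n)! := fun n => by rw [pow_mul]; positivity
  have hterm : ∀ n : ℕ, |z ^ (2 * n) / (2 * n)! * (mX (2 * n) - c n * mX 2 ^ n)| ≤
      z ^ (2 * n) / (2 * n)! * (c n * mY 2 ^ n - mY (2 * n)) := fun n => by
    rw [abs_mul, abs_of_nonneg (hz n)]
    exact mul_le_mul_of_nonneg_left (abs_expectIn_pow_sub_wick_le hJ hβ Λ lam n) (hz n)
  have hup := hasSum_le (fun n => (le_abs_self _).trans (hterm n)) hA hB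
  have hlo := hasSum_le (fun n => (neg_le.1 ((neg_le_abs _).trans (hterm n)))) hB.neg hA
  exact abs_le.2 ⟨by linarith, hup⟩

end Summation

/-! ### Step 3: Newman's Lee–Yang lower bound and the fourth cumulant -/

section Cumulant

variable {J : Site d → Site d → ℝ} {β : ℝ}

/-- **From Newman's two-sided bound (`newman_mgf_bounds`, proved) to the fourth cumulant**: for
`Y = ∑ μ_xσ_x` with `μ ≥ 0`,
`e^{z²⟨Y²⟩/2} - ⟨e^{zY}⟩_Λ ≤ e^{z²⟨Y²⟩/2} · (3⟨Y²⟩² - ⟨Y⁴⟩) z⁴/24` and `⟨Y⁴⟩ ≤ 3⟨Y²⟩²`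
(`u₄ ≤ 0` because the lower bound of (2.5), `k = 1`, sits below the upper bound, `k = 0`;
then `1 - e^{-a} ≤ a`). [cite: Newman1975, Theorem 4, eq. (2.5)] -/
theorem exp_sub_expectIn_exp_le (hJ : ∀ x y, 0 ≤ J x y)
    (hβ : 0 ≤ β) (Λ : Finset (Site d)) {mu : Site d → ℝ} (hmu : ∀ x, 0 ≤ mu x) (z : ℝ) :
    expectIn J Λ β 0 (fun σ => (∑ x ∈ Λ, mu x * spinAt x σ) ^ 4) ≤
        3 * expectIn J Λ β 0 (fun σ => (∑ x ∈ Λ, mu x * spinAt x σ) ^ 2) ^ 2 ∧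
      Real.exp (z ^ 2 / 2 * expectIn J Λ β 0 (fun σ => (∑ x ∈ Λ, mu x * spinAt x σ) ^ 2)) -
          expectIn J Λ β 0 (fun σ => Real.exp (z * ∑ x ∈ Λ, mu x * spinAt x σ)) ≤
        Real.exp (z ^ 2 / 2 * expectIn J Λ β 0 (fun σ => (∑ x ∈ Λ, mu x * spinAt x σ) ^ 2)) *
          ((3 * expectIn J Λ β 0 (fun σ => (∑ x ∈ Λ, mu x * spinAt x σ) ^ 2) ^ 2 -
            expectIn J Λ β 0 (fun σ => (∑ x ∈ Λ, mu x * spinAt x σ) ^ 4)) * z ^ 4 / 24) := by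
  set V : ℝ := expectIn J Λ β 0 (fun σ => (∑ x ∈ Λ, mu x * spinAt x σ) ^ 2) with hV
  set m4 : ℝ := expectIn J Λ β 0 (fun σ => (∑ x ∈ Λ, mu x * spinAt x σ) ^ 4) with hm4
  set u4 : ℝ := m4 - 3 * V ^ 2 with hu4
  -- `u₄ ≤ 0` from the two bounds at `r = 1`
  have h1 := newman_mgf_bounds J hJ hβ Λ hmu 1
  have hu4le : u4 ≤ 0 := by
    have h := h1.1.trans h1.2
    rw [Real.exp_le_exp] at h
    simp only [one_pow, mul_one] at h
    change V / 2 + u4 / 24 ≤ V / 2 at h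
    linarith
  refine ⟨by linarith, ?_⟩
  -- the lower bound at `r = z`
  have hz := (newman_mgf_bounds J hJ hβ Λ hmu z).1
  change Real.exp (V * z ^ 2 / 2 + u4 * z ^ 4 / 24) ≤ _ at hz
  set a : ℝ := -(u4 * z ^ 4 / 24) with ha
  have ha0 : 0 ≤ a := by
    rw [ha, neg_nonneg]
    exact div_nonpos_of_nonpos_of_nonneg (mul_nonpos_of_nonpos_of_nonneg hu4le (by positivity)) (by norm_num)
  have hexp : Real.exp (V * z ^ 2 / 2 + u4 * z ^ 4 / 24) = Real.exp (z ^ 2 / 2 * V) * Real.exp (-a) := by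
    rw [← Real.exp_add]; congr 1; rw [ha]; ring
  have hkey : 1 - Real.exp (-a) ≤ a := by linarith [Real.add_one_le_exp (-a)]
  have hE0 : 0 ≤ Real.exp (z ^ 2 / 2 * V) := (Real.exp_pos _).le
  calc Real.exp (z ^ 2 / 2 * V) - expectIn J Λ β 0 (fun σ => Real.exp (z * ∑ x ∈ Λ, mu x * spinAt x σ))
      ≤ Real.exp (z ^ 2 / 2 * V) - Real.exp (z ^ 2 / 2 * V) * Real.exp (-a) := by rw [← hexp]; linarith
    _ = Real.exp (z ^ 2 / 2 * V) * (1 - Real.exp (-a)) := by ring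
    _ ≤ Real.exp (z ^ 2 / 2 * V) * a := mul_le_mul_of_nonneg_left hkey hE0
    _ = Real.exp (z ^ 2 / 2 * V) * ((3 * V ^ 2 - m4) * z ^ 4 / 24) := by rw [ha, hu4]; ring

end Cumulant

/-! ### The fourth cumulant of a linear observable as a smeared four-point Ursell function -/

section Ursell

/-- The square of a smeared two-point function as a sum over `Λ⁴`:
`(∑_{a,b} w_aw_b S(a,b))² = ∑_{p∈Λ⁴} ∏w_{pᵢ} S(p₀,p₁)S(p₂,p₃)`. [folklore] -/
theorem sq_sum₂_eq_sum_piFinset_four {α : Type*} (Λ : Finset α) (w : α → ℝ) (S : α → α → ℝ) :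
    (∑ a ∈ Λ, ∑ b ∈ Λ, w a * w b * S a b) ^ 2 =
      ∑ p ∈ Fintype.piFinset (fun _ : Fin 4 => Λ), (∏ i, w (p i)) * (S (p 0) (p 1) * S (p 2) (p 3)) := by
  classical
  set Φ : (Fin 2 → α) → ℝ := fun q => w (q 0) * w (q 1) * S (q 0) (q 1) with hΦ
  have h2 : ∑ a ∈ Λ, ∑ b ∈ Λ, w a * w b * S a b = ∑ q ∈ Fintype.piFinset (fun _ : Fin 2 => Λ), Φ q := by
    rw [sum_piFinset_fin_two]
    rfl
  have hsplit := sum_piFinset_split Λ (finSumFinEquiv : Fin 2 ⊕ Fin 2 ≃ Fin 4) Φ Φ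
  rw [h2, sq, ← hsplit]
  refine Finset.sum_congr rfl fun p _ => ?_
  simp only [hΦ, finSumFinEquiv_apply_left, finSumFinEquiv_apply_right, Fin.prod_univ_four]
  have e0 : (Fin.castAdd 2 (0 : Fin 2) : Fin 4) = 0 := rfl
  have e1 : (Fin.castAdd 2 (1 : Fin 2) : Fin 4) = 1 := rfl
  have e2 : (Fin.natAdd 2 (0 : Fin 2) : Fin 4) = 2 := rfl
  have e3 : (Fin.natAdd 2 (1 : Fin 2) : Fin 4) = 3 := rfl
  rw [e0, e1, e2, e3]
  ring

/-- **The three pairings of four points**: for a symmetric kernel `S`,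
`3 (∑_{a,b} w_aw_b S(a,b))² = ∑_{p∈Λ⁴} ∏w_{pᵢ} (S₀₁S₂₃ + S₀₂S₁₃ + S₀₃S₁₂)(p)` (relabel the
coordinates by the transpositions `(1 2)` and `(1 3)`). [folklore] -/
theorem three_mul_sq_sum₂_eq {α : Type*} (Λ : Finset α) (w : α → ℝ) (S : α → α → ℝ)
    (hS : ∀ a b, S a b = S b a) :
    3 * (∑ a ∈ Λ, ∑ b ∈ Λ, w a * w b * S a b) ^ 2 =
      ∑ p ∈ Fintype.piFinset (fun _ : Fin 4 => Λ), (∏ i, w (p i)) *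
        (S (p 0) (p 1) * S (p 2) (p 3) + S (p 0) (p 2) * S (p 1) (p 3) + S (p 0) (p 3) * S (p 1) (p 2)) := by
  classical
  set Ψ : (Fin 4 → α) → ℝ := fun p => (∏ i, w (p i)) * (S (p 0) (p 1) * S (p 2) (p 3)) with hΨ
  have hbase : (∑ a ∈ Λ, ∑ b ∈ Λ, w a * w b * S a b) ^ 2 =
      ∑ p ∈ Fintype.piFinset (fun _ : Fin 4 => Λ), Ψ p := sq_sum₂_eq_sum_piFinset_four Λ w S
  have hprod : ∀ (τ : Equiv.Perm (Fin 4)) (p : Fin 4 → α), ∏ i, w ((p ∘ τ) i) = ∏ i, w (p i) :=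
    fun τ p => Equiv.prod_comp τ (fun i => w (p i))
  -- channel `(0 2)(1 3)`: relabel by the transposition `1 ↔ 2`
  have h13 : ∑ p ∈ Fintype.piFinset (fun _ : Fin 4 => Λ), (∏ i, w (p i)) * (S (p 0) (p 2) * S (p 1) (p 3)) =
      ∑ p ∈ Fintype.piFinset (fun _ : Fin 4 => Λ), Ψ p := by
    rw [← sum_piFinset_comp_perm Λ (Equiv.swap (1 : Fin 4) 2) Ψ]
    refine Finset.sum_congr rfl fun p _ => ?_
    rw [hΨ]
    dsimp only
    rw [hprod]
    simp [Function.comp_apply, Equiv.swap_apply_of_ne_of_ne, Equiv.swap_apply_left, Equiv.swap_apply_right]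
  -- channel `(0 3)(1 2)`: relabel by the transposition `1 ↔ 3`
  have h14 : ∑ p ∈ Fintype.piFinset (fun _ : Fin 4 => Λ), (∏ i, w (p i)) * (S (p 0) (p 3) * S (p 1) (p 2)) =
      ∑ p ∈ Fintype.piFinset (fun _ : Fin 4 => Λ), Ψ p := by
    rw [← sum_piFinset_comp_perm Λ (Equiv.swap (1 : Fin 4) 3) Ψ]
    refine Finset.sum_congr rfl fun p _ => ?_
    rw [hΨ]
    dsimp only
    rw [hprod]
    simp [Function.comp_apply, Equiv.swap_apply_of_ne_of_ne, Equiv.swap_apply_left, Equiv.swap_apply_right,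
      hS (p 2) (p 1)]
  simp_rw [mul_add]
  rw [Finset.sum_add_distrib, Finset.sum_add_distrib, h13, h14, ← hbase]
  ring

variable (J : Site d → Site d → ℝ) (Λ : Finset (Site d)) (β : ℝ)

/-- **The fourth cumulant of `Y = ∑ μ_xσ_x` is the smeared four-point Ursell function**:
`⟨Y⁴⟩_Λ - 3⟨Y²⟩_Λ² = ∑_{p∈Λ⁴} ∏μ_{pᵢ} U₄^Λ(p₀,p₁,p₂,p₃)` (`ursellFourIn` of
`LongRangeTrivialityOnZ3Wick`). [folklore] -/
theorem expectIn_pow_four_sub_three_sq (mu : Site d → ℝ) :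
    expectIn J Λ β 0 (fun σ => (∑ x ∈ Λ, mu x * spinAt x σ) ^ 4) -
        3 * expectIn J Λ β 0 (fun σ => (∑ x ∈ Λ, mu x * spinAt x σ) ^ 2) ^ 2 =
      ∑ p ∈ Fintype.piFinset (fun _ : Fin 4 => Λ), (∏ i, mu (p i)) * ursellFourIn J Λ β p := by
  have hS : ∀ a b : Site d, expectIn J Λ β 0 (fun σ => spinAt a σ * spinAt b σ) =
      expectIn J Λ β 0 (fun σ => spinAt b σ * spinAt a σ) := fun a b => by simp_rw [mul_comm]
  rw [expectIn_linear_pow J Λ β mu 4, expectIn_linear_sq,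
    three_mul_sq_sum₂_eq Λ mu (fun a b => expectIn J Λ β 0 (fun σ => spinAt a σ * spinAt b σ)) hS,
    ← Finset.sum_sub_distrib]
  refine Finset.sum_congr rfl fun p _ => ?_
  rw [ursellFourIn, corrIn, pairIn, pairIn, pairIn, pairIn, pairIn, pairIn, ← mul_sub]
  congr 1
  ring

end Ursell

/-! ### Step 4: the smeared observable in a finite volume containing the lattice support -/

section Smeared

variable {J : Site d → Site d → ℝ} {β : ℝ}

/-- **The moment-generating-function bound in finite volume.** For
`J ≥ 0`, `β ≥ 0`, `L ≥ 1`, `f` continuous with `f = 0` off `[-R,R]^d`, a finite volume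
`Λ ⊇ Λ_{RL}` and real `z`:
`|⟨e^{zT_{f,L,β}}⟩_Λ - e^{z²⟨T_{f,L,β}²⟩_Λ/2}| ≤ (z⁴/24) e^{z²⟨T_{|f|,L,β}²⟩_Λ/2} ‖f‖_∞⁴ Σ_L(β)⁻² ∑_{Λ_{RL}⁴} |U₄^Λ|`
(steps 1–3 of the module docstring, with `λ_x = f(x/L)/Σ_L(β)^{1/2}` and `∏|λ_{xᵢ}| ≤ ‖f‖_∞⁴Σ_L⁻²`,
the smeared sum living on `Λ_{RL}⁴`). [cite: Panis2023Triviality, proof of Theorem 5.5, first two displays (p. 21)] -/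
theorem abs_expectIn_exp_smeared_sub_le
    (hJ : ∀ x y, 0 ≤ J x y) (hβ : 0 ≤ β) {L R : ℕ} (hL : 1 ≤ L) {f : EuclideanSpace ℝ (Fin d) → ℝ}
    (hf : Continuous f) (hfR : ∀ x, f x ≠ 0 → ∀ i, |x i| ≤ R) {Λ : Finset (Site d)}
    (hΛ : box d (R * L) ⊆ Λ) (z : ℝ) :
    |expectIn J Λ β 0 (fun σ => Real.exp (z * smeared J β L f σ)) -
        Real.exp (z ^ 2 / 2 * expectIn J Λ β 0 (fun σ => smeared J β L f σ ^ 2))| ≤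
      1 / 24 * z ^ 4 * Real.exp (z ^ 2 / 2 * expectIn J Λ β 0 (fun σ => smeared J β L (fun x => |f x|) σ ^ 2)) *
        (⨆ x, |f x|) ^ 4 *
        ((∑ p ∈ Fintype.piFinset (fun _ : Fin 4 => box d (R * L)), |ursellFourIn J Λ β p|) /
          blockVariance J β L ^ 2) := by
  -- the lattice support and the coefficients `λ_x = f(x/L)/Σ_L^{1/2}`
  set B : Finset (Site d) := box d (R * L) with hB
  have hsuppB : ∀ x : Site d, f ((L : ℝ)⁻¹ • siteVec x) ≠ 0 → x ∈ B :=
    fun x hx => mem_box_mul_of_apply_ne_zero hfR hL x hx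
  have hfaR : ∀ x, (fun y => |f y|) x ≠ 0 → ∀ i, |x i| ≤ R := fun x hx => hfR x (abs_ne_zero.mp hx)
  have hsuppBa : ∀ x : Site d, (fun y => |f y|) ((L : ℝ)⁻¹ • siteVec x) ≠ 0 → x ∈ B :=
    fun x hx => mem_box_mul_of_apply_ne_zero hfaR hL x hx
  set sV : ℝ := Real.sqrt (blockVariance J β L) with hsV
  have hV1 : 1 ≤ blockVariance J β L := one_le_blockVariance J β hβ hJ L
  have hV0 : 0 < blockVariance J β L := by linarith
  have hsV0 : 0 < sV := Real.sqrt_pos.2 hV0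
  set lam : Site d → ℝ := fun x => f ((L : ℝ)⁻¹ • siteVec x) / sV with hlam
  have hlam_abs : ∀ x, |lam x| = |f ((L : ℝ)⁻¹ • siteVec x)| / sV := fun x => by
    rw [hlam]
    dsimp only
    rw [abs_div, abs_of_pos hsV0]
  have hT : ∀ σ, smeared J β L f σ = ∑ x ∈ Λ, lam x * spinAt x σ := by
    intro σ
    rw [smeared_eq_sum_div_sqrt J β L f (fun x hx => hΛ (hsuppB x hx)) σ, Finset.sum_div]
    refine Finset.sum_congr rfl fun x _ => ?_
    rw [hlam]
    ring
  have hTa : ∀ σ, smeared J β L (fun x => |f x|) σ = ∑ x ∈ Λ, |lam x| * spinAt x σ := by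
    intro σ
    rw [smeared_eq_sum_div_sqrt J β L (fun x => |f x|) (fun x hx => hΛ (hsuppBa x hx)) σ, Finset.sum_div]
    refine Finset.sum_congr rfl fun x _ => ?_
    rw [hlam_abs]
    ring
  -- steps 1–2 (summation with absolute values inside) and step 3 (Lee–Yang lower bound)
  have h12 := abs_expectIn_exp_sub_exp_le J Λ β hJ hβ lam z
  have h3 := (exp_sub_expectIn_exp_le hJ hβ Λ (mu := fun x => |lam x|) (fun x => abs_nonneg _) z).2
  -- the fourth cumulant as a smeared Ursell sum, and its bound
  set VY : ℝ := expectIn J Λ β 0 (fun σ => (∑ x ∈ Λ, |lam x| * spinAt x σ) ^ 2) with hVY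
  set m4 : ℝ := expectIn J Λ β 0 (fun σ => (∑ x ∈ Λ, |lam x| * spinAt x σ) ^ 4) with hm4
  set M : ℝ := ⨆ x, |f x| with hM
  have hM0 : 0 ≤ M := iSup_abs_nonneg f
  have hfM : ∀ y, |f y| ≤ M := by
    have hbdd : BddAbove (Set.range fun x => |f x|) :=
      (hf.abs).bddAbove_range_of_hasCompactSupport ((hasCompactSupport_of_cube hfR).comp_left abs_zero)
    intro y
    exact le_ciSup hbdd y
  set U : ℝ := ∑ p ∈ Fintype.piFinset (fun _ : Fin 4 => B), |ursellFourIn J Λ β p| with hU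
  have hU0 : 0 ≤ U := Finset.sum_nonneg fun p _ => abs_nonneg _
  have hcum : 3 * VY ^ 2 - m4 ≤ M ^ 4 * (U / blockVariance J β L ^ 2) := by
    have hid := expectIn_pow_four_sub_three_sq J Λ β (fun x => |lam x|)
    change m4 - 3 * VY ^ 2 = _ at hid
    -- the smeared sum lives on `B⁴`
    have hvan : ∀ p ∈ Fintype.piFinset (fun _ : Fin 4 => Λ), p ∉ Fintype.piFinset (fun _ : Fin 4 => B) →
        (∏ i, |lam (p i)|) * ursellFourIn J Λ β p = 0 := by
      intro p _ hp
      rw [Fintype.mem_piFinset, not_forall] at hp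
      obtain ⟨i, hi⟩ := hp
      have h0 : lam (p i) = 0 := by
        rw [hlam]
        dsimp only
        rw [div_eq_zero_iff]
        exact Or.inl (by_contra fun h => hi (hsuppB _ h))
      rw [Finset.prod_eq_zero (Finset.mem_univ i) (by rw [h0, abs_zero]), zero_mul]
    have hsub : Fintype.piFinset (fun _ : Fin 4 => B) ⊆ Fintype.piFinset (fun _ : Fin 4 => Λ) :=
      Fintype.piFinset_subset _ _ fun _ => hΛ
    rw [← Finset.sum_subset hsub hvan] at hid
    -- `∏ |λ_{pᵢ}| ≤ M⁴ Σ_L⁻²`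
    have hprod : ∀ p : Fin 4 → Site d, ∏ i, |lam (p i)| ≤ M ^ 4 / blockVariance J β L ^ 2 := by
      intro p
      have h1 : ∏ i, |lam (p i)| ≤ ∏ _i : Fin 4, M / sV :=
        Finset.prod_le_prod (fun i _ => abs_nonneg _) fun i _ => by
          rw [hlam_abs]
          exact div_le_div_of_nonneg_right (hfM _) hsV0.le
      rw [Finset.prod_const, Finset.card_univ, Fintype.card_fin, div_pow] at h1
      have h2 : sV ^ 4 = blockVariance J β L ^ 2 := by
        rw [show (4 : ℕ) = 2 * 2 from rfl, pow_mul, hsV, Real.sq_sqrt hV0.le]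
      rwa [h2] at h1
    calc 3 * VY ^ 2 - m4 = -∑ p ∈ Fintype.piFinset (fun _ : Fin 4 => B), (∏ i, |lam (p i)|) * ursellFourIn J Λ β p := by
          rw [← hid]; ring
      _ ≤ ∑ p ∈ Fintype.piFinset (fun _ : Fin 4 => B), (∏ i, |lam (p i)|) * |ursellFourIn J Λ β p| := by
          rw [← Finset.sum_neg_distrib]
          refine Finset.sum_le_sum fun p _ => ?_
          rw [← mul_neg]
          exact mul_le_mul_of_nonneg_left (neg_le_abs _) (Finset.prod_nonneg fun i _ => abs_nonneg _)
      _ ≤ ∑ p ∈ Fintype.piFinset (fun _ : Fin 4 => B), M ^ 4 / blockVariance J β L ^ 2 * |ursellFourIn J Λ β p| :=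
          Finset.sum_le_sum fun p _ => mul_le_mul_of_nonneg_right (hprod p) (abs_nonneg _)
      _ = M ^ 4 * (U / blockVariance J β L ^ 2) := by rw [hU, ← Finset.mul_sum]; ring
  -- assemble
  have hfun1 : (fun σ => Real.exp (z * smeared J β L f σ)) = fun σ => Real.exp (z * ∑ x ∈ Λ, lam x * spinAt x σ) :=
    funext fun σ => by rw [hT]
  have hfun2 : (fun σ => smeared J β L f σ ^ 2) = fun σ => (∑ x ∈ Λ, lam x * spinAt x σ) ^ 2 :=
    funext fun σ => by rw [hT]
  have hfun3 : (fun σ => smeared J β L (fun x => |f x|) σ ^ 2) = fun σ => (∑ x ∈ Λ, |lam x| * spinAt x σ) ^ 2 :=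
    funext fun σ => by rw [hTa]
  rw [hfun1, hfun2, hfun3]
  have hE0 : 0 ≤ Real.exp (z ^ 2 / 2 * VY) := (Real.exp_pos _).le
  have hz4 : 0 ≤ z ^ 4 := by positivity
  calc |expectIn J Λ β 0 (fun σ => Real.exp (z * ∑ x ∈ Λ, lam x * spinAt x σ)) -
        Real.exp (z ^ 2 / 2 * expectIn J Λ β 0 (fun σ => (∑ x ∈ Λ, lam x * spinAt x σ) ^ 2))|
      ≤ Real.exp (z ^ 2 / 2 * VY) -
          expectIn J Λ β 0 (fun σ => Real.exp (z * ∑ x ∈ Λ, |lam x| * spinAt x σ)) := h12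
    _ ≤ Real.exp (z ^ 2 / 2 * VY) * ((3 * VY ^ 2 - m4) * z ^ 4 / 24) := h3
    _ ≤ Real.exp (z ^ 2 / 2 * VY) * ((M ^ 4 * (U / blockVariance J β L ^ 2)) * z ^ 4 / 24) := by
        refine mul_le_mul_of_nonneg_left ?_ hE0
        exact div_le_div_of_nonneg_right (mul_le_mul_of_nonneg_right hcum hz4) (by norm_num)
    _ = 1 / 24 * z ^ 4 * Real.exp (z ^ 2 / 2 * VY) * M ^ 4 * (U / blockVariance J β L ^ 2) := by ring

end Smeared

end LongRangeIsing

open LongRangeIsing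

/-! ### Step 5: the limit along boxes — `panis_mgfDeviation_le_ursellFourBoxSum` discharged -/

/-- **DISCHARGE of `panis_mgfDeviation_le_ursellFourBoxSum`** (Panis 2023, proof of Theorem 5.5,
second display, p. 21), with constant `C₁ = 1/24`: the finite-volume bound
`LongRangeIsing.abs_expectIn_exp_smeared_sub_le` in the boxes `Λ_M ⊇ Λ_{RL}` (Newman's Gaussian
inequality for correlations — the tree's `corrIn_le_pairingSum` — and Newman's Lee–Yang lower bound
on the moment generating function — `newman_mgf_bounds`, from the tree's
`lee_yang_circle_theorem_finite_holds`), and the window law of the infinite-volume state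
(`tendsto_expectIn_box_fun_smeared`, `tendsto_ursellFourIn_box`), the inequality being closed. Valid
for every ferromagnetic pair interaction; specialised to Panis's algebraically decaying couplings as
the fact demands. No random currents and no Aizenman Prop. 12.1 are used.
[cite: Panis2023Triviality, proof of Theorem 5.5, first two displays (p. 21)] [cite: Newman1975, Theorem 4, eq. (2.5)] -/
theorem panis_mgfDeviation_le_ursellFourBoxSum_holds : panis_mgfDeviation_le_ursellFourBoxSum := by
  intro d hd C₀ α hC₀ hα hexp
  refine ⟨1 / 24, by norm_num, ?_⟩
  intro β hβ hβc L R hL hR f hf hfR z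
  set J := algebraicCoupling d C₀ α with hJdef
  have hJ : ∀ x y, 0 ≤ J x y := algebraicCoupling_nonneg hC₀.le α
  have hβ0 : 0 ≤ β := hβ.le
  set B : Finset (Site d) := box d (R * L) with hB
  have hsupp : ∀ x : Site d, f ((L : ℝ)⁻¹ • siteVec x) ≠ 0 → x ∈ B :=
    fun x hx => mem_box_mul_of_apply_ne_zero hfR hL x hx
  have hfaR : ∀ x, (fun y => |f y|) x ≠ 0 → ∀ i, |x i| ≤ R := fun x hx => hfR x (abs_ne_zero.mp hx)
  have hsuppa : ∀ x : Site d, (fun y => |f y|) ((L : ℝ)⁻¹ • siteVec x) ≠ 0 → x ∈ B :=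
    fun x hx => mem_box_mul_of_apply_ne_zero hfaR hL x hx
  -- the finite-volume inequality in the boxes `Λ_M ⊇ B`
  obtain ⟨M₀, hM₀⟩ := exists_forall_subset_box d B
  have hfin : ∀ᶠ M : ℕ in atTop,
      |expectIn J (box d M) β 0 (fun σ => Real.exp (z * smeared J β L f σ)) -
          Real.exp (z ^ 2 / 2 * expectIn J (box d M) β 0 (fun σ => smeared J β L f σ ^ 2))| ≤
        1 / 24 * z ^ 4 *
          Real.exp (z ^ 2 / 2 * expectIn J (box d M) β 0 (fun σ => smeared J β L (fun x => |f x|) σ ^ 2)) *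
          (⨆ x, |f x|) ^ 4 *
          ((∑ p ∈ Fintype.piFinset (fun _ : Fin 4 => B), |ursellFourIn J (box d M) β p|) /
            blockVariance J β L ^ 2) := by
    filter_upwards [eventually_ge_atTop M₀] with M hM
    exact abs_expectIn_exp_smeared_sub_le hJ hβ0 hL hf hfR (hM₀ M hM) z
  -- every term converges along the boxes
  have hlhs : Tendsto (fun M : ℕ =>
      |expectIn J (box d M) β 0 (fun σ => Real.exp (z * smeared J β L f σ)) -
          Real.exp (z ^ 2 / 2 * expectIn J (box d M) β 0 (fun σ => smeared J β L f σ ^ 2))|) atTop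
      (𝓝 (mgfDeviation J β L f z)) := by
    rw [mgfDeviation]
    exact ((tendsto_expectIn_box_fun_smeared J β hβ0 hJ L f hsupp fun t => Real.exp (z * t)).sub
      ((Real.continuous_exp.tendsto _).comp
        ((tendsto_expectIn_box_fun_smeared J β hβ0 hJ L f hsupp fun t => t ^ 2).const_mul _))).abs
  have hrhs : Tendsto (fun M : ℕ => 1 / 24 * z ^ 4 *
      Real.exp (z ^ 2 / 2 * expectIn J (box d M) β 0 (fun σ => smeared J β L (fun x => |f x|) σ ^ 2)) *
      (⨆ x, |f x|) ^ 4 *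
      ((∑ p ∈ Fintype.piFinset (fun _ : Fin 4 => B), |ursellFourIn J (box d M) β p|) /
        blockVariance J β L ^ 2)) atTop
      (𝓝 (1 / 24 * z ^ 4 *
        Real.exp (z ^ 2 / 2 * state J β 0 (fun σ => smeared J β L (fun x => |f x|) σ ^ 2)) *
        (⨆ x, |f x|) ^ 4 * ursellFourBoxSum J β L R)) := by
    have hexp2 : Tendsto (fun M : ℕ =>
        Real.exp (z ^ 2 / 2 * expectIn J (box d M) β 0 (fun σ => smeared J β L (fun x => |f x|) σ ^ 2)))
        atTop (𝓝 (Real.exp (z ^ 2 / 2 * state J β 0 (fun σ => smeared J β L (fun x => |f x|) σ ^ 2)))) :=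
      (Real.continuous_exp.tendsto _).comp
        ((tendsto_expectIn_box_fun_smeared J β hβ0 hJ L (fun x => |f x|) hsuppa fun t => t ^ 2).const_mul _)
    have hU : Tendsto (fun M : ℕ =>
        (∑ p ∈ Fintype.piFinset (fun _ : Fin 4 => B), |ursellFourIn J (box d M) β p|) /
          blockVariance J β L ^ 2) atTop (𝓝 (ursellFourBoxSum J β L R)) := by
      rw [ursellFourBoxSum]
      exact (tendsto_finsetSum _ fun p _ => (tendsto_ursellFourIn_box J β hβ0 hJ p).abs).div_const _
    exact ((hexp2.const_mul _).mul_const _).mul hU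
  exact le_of_tendsto_of_tendsto hlhs hrhs hfin

/-- **Theorem 1.2 from the single remaining input, the bound on `S(β,L,f)`** (`panis_ursellFourBoxSum_le`,
p. 22 of the source). [cite: Panis2023Triviality, proof of Theorem 5.5 (pp. 21–22)] -/
theorem panis_thm12_of_ursellFourBoxSum_le (hS : panis_ursellFourBoxSum_le) : panis_thm12 :=
  panis_thm12_of_inputs panis_mgfDeviation_le_ursellFourBoxSum_holds hS

/-- **The barrier `LongRangeTrivialityOnZ3` from the bound on `S(β,L,f)` alone.**
[cite: Panis2023Triviality, Theorem 1.2 and proof of Theorem 5.5] -/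
theorem LongRangeTrivialityOnZ3.of_ursellFourBoxSum_le (hS : panis_ursellFourBoxSum_le) : LongRangeTrivialityOnZ3 :=
  LongRangeTrivialityOnZ3.of_thm12 (panis_thm12_of_ursellFourBoxSum_le hS)



end Literature.Barriers.CriticalPhenomena

end
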